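import Mathlib
import HarnessLib
import Summits.Parity.GeneralizedHardyLittlewood.Theses.LeeYangFibres
import Summits.Parity.GeneralizedHardyLittlewood.Theorems.LeeYangFibresModelHyperbolicityWindowChain
import Summits.Parity.GeneralizedHardyLittlewood.Theorems.LeeYangFibresModelHyperbolicityCalculus

/-!
# Disproof work file for crux `ModelHyperbolicity` (stmt-Parity-14110) — cdisprove seat (gen-2; extended by the gen-3 seat, crux cycle 2, and the gen-4 seat, crux cycle 3)

Crux (route LeeYangFibres, rank 4; verbatim gen-1 stmt-Parity-7944): for every `u ≥ 2` and all large
`x`, the rough-integer cell polynomial `P_{u,x}(z) = Σ_{j ≤ u} A_j(x) z^j`,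
`A_j(x) = #{n ≤ x : x^{1/u} < P⁻(n), Ω(n) = j}`, has only real zeros. In the notation of §0:
`∀ u ≥ 2, ∃ x₀, ∀ x ≥ x₀, RealRootedAt u x` (`crux_iff`, `Iff.rfl`). Always `A_0 = A_u = 0`
(`cell_zero`, `cell_eq_zero_of_le`), so `P_{u,x}(z) = z · Q_{u,x}(z)` with the REDUCED real polynomial
`Q_{u,x} = Σ_{j<u} A_{j+1} X^j ∈ ℝ[X]` of degree `≤ u − 2` (`cellPolyQ`, `cellPoly_eq_mul_Q`,
`natDegree_cellPolyQ_le`).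

## VERDICT (cycle 3, gen-4 seat, 2026-08-16T03:5xZ): NO KILL — THE CRUX IS PROVED; the last open question of this file is settled

State read at cycle start: the seventh stub `stub_cellRate` landed (p76336) and the lead's composition
`Theorems/LeeYangFibresModelHyperbolicity.lean` — `ModelHyperbolicity_of : ModelHyperbolicity`, i.e. the
route declaration BY NAME, `crux_iff.mpr (stub_glue stub_calculus stub_windowChain stub_simpleZeros
stub_transfer (stub_cellRate stub_calculus) stub_cellLimit)` — is IN THE TREE (p77326, written 03:28Z).
Nothing is left to disprove; this cycle closes the one question the file still listed as OPEN (cycle 2,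
"quantitative only"): is the threshold `x₀(u)` CONDITIONING-governed (`log x₀(u) ≳ e^{cu}`, incoherent
`1/log x` corrections at the locked zeros `−1, −2, …`) or GRANULARITY-governed? ANSWER: granularity —
entirely. Three findings (§I; numerics `num/limodel.py`, stdlib `decimal`, 110 digits, reproducible):
* (I-a) SUPERPOSITION IDENTITY (the `li`-model). Replace the primes by the measure `dli(p) = dp/log p`:
  `A_j^{li}(x) := (1/j!)·∫_{p_i > y, ∏p_i ≤ x} ∏ dli(p_i)`. Then, EXACTLY,
  `A_j^{li}(x) = ∫_j^u y^v I_j(v) dv/v` and `Q^{li}_{u,x}(t) := Σ_{j≥1} A_j^{li}(x) t^{j−1} = ∫_1^u y^v G(v;t) dv/v`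
  (`y = x^{1/u}`; proof: `p_i = x^{s_i}` turns `∏ dli(p_i)` into `x^{Σ s_i} ∏ ds_i/s_i`, the slice
  `Σ s_i = σ` of `{s_i > 1/u}` has `∏ds/s`-mass `σ^{-1}·j!·I_j(uσ)` by the scale invariance of `ds/s`,
  and `v = uσ`; `j = 1` reads `li(x) − li(y)`; checked against direct 2-D/3-D quadrature to 6 digits).
  So the main term of the finite-`x` polynomial is a POSITIVE AVERAGE of the limit polynomials `G(v;·)`,
  `v ≤ u`, with weight `y^v dv/v`; Watson's lemma on it gives the first correction explicitly,
  `A_j(x) = (x/log x)·[I_j(u) + (I_j(u) − u·I_j'(u))/log x + O_u(log^{-2} x)]` — a scalar plus a SHIFT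
  `u ↦ u − 1/log y`, i.e. coherent (and at `t = −k` one has `∂_u G(u;−k) = −k·G(u−1;−k)/(u−1)`, again a
  transient). Heuristic reason for coherence at every order: `Σ_{n ≤ x, P⁻(n) > y} z^{Ω(n)}` has Dirichlet
  series `ζ(s)^z·H_y(s)`, whose Selberg–Delange expansion `x(log x)^{z−1} Σ_i c_i/(Γ(z−i) log^i x)`
  vanishes termwise at `z = −k` (`ζ^{−k}H` is regular at `s = 1`): the near-cancellation of the cell
  polynomial at the locked points is structural at finite `x`, not an artefact of the limit.
* (I-b) THE UNIT WINDOW SPANS A HYPERBOLIC CONE — Lean, sorry-free, UNCONDITIONAL on the landed chain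
  (`window_combination_ne_zero`, §I below): for `1 ≤ a`, `a + 1 ≤ N`, nodes `v_i ∈ [a, a+1]` and weights
  `w_i ≥ 0` not all zero, `Σ_i w_i·G_N(v_i; z) ≠ 0` whenever `Im z ≠ 0`. Proof: the landed pair
  `Im(G(v)/G(a)) ≥ 0`, `Im(z·G(a)/G(v)) > 0` (`stub_windowChain stub_calculus`) puts every `G(v_i)/G(a)` in
  the sector `0 ≤ arg < arg z`, on which the SECTOR FUNCTIONAL `ℓ_z(w) = Re w·(‖z‖ + Re z) + Im w·Im z`
  (inner product with the bisector `‖z‖ + z`) is positive (`sector_functional_pos`) and `ℝ`-linear.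
  Integral form, also Lean (`window_integral_ne_zero`, the functional pushed through `∫` as a continuous
  `ℝ`-linear map): `∫_a^{a+1} w(v) G(v;z) dv ≠ 0` off `ℝ` for every weight `w` continuous and positive
  on the window — so the window part `∫_{u−1}^u y^v G(v;t) dv/v` of `Q^{li}` is real-rooted for EVERY
  `y > 0` (numerically confirmed for `y ∈ [0.1, 10³]`, `u ≤ 24`, and also for windows of length `2`);
  the TOP of the `li`-model polynomial never fails.
* (I-c) THE SMOOTH THRESHOLD IS BOUNDED: `y₀^{li}(u) := sup{y : Q^{li}_{u,y^u} not real-rooted}` equals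
  `0.947, 1.281, 1.406, 1.446, 1.451, 1.443, 1.430, 1.415, 1.409, 1.434, 1.446, 1.451, 1.451` for
  `u = 5, …, 17`, then oscillates in `[1.439, 1.4514]` with quasi-period `≈ 8` up to `u = 60`
  (maxima `1.45137` at `u = 32, 40, 48`, `1.45135` at `56`; `u = 4`: real-rooted for every `y ≥ 0.3`);
  `Q^{li}_{u,y^u}` is real-rooted for EVERY `y ≥ 1.46` and every `u ≤ 60` tested (grid `y ≤ 10⁴`), while at
  `y = 1` it has `≈ 0.45u` non-real zeros. The failure below `1.45` is the collision of the two INNERMOST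
  locked zeros (at `u = 12`: `−1.00, −2.02` at `y = 3` drift to a double zero `−1.74` at `y₀ = 1.4145`),
  fed by the far tail `v < u − 2` of the superposition (`G(v;−1), G(v;−2)` are not small for small `v`
  and the weight `y^{v−u}` no longer decays). So in the smooth model `x > 1.46^u` suffices for all `u`:
  the conditioning scenario is DEAD, and EVERY bit of the true threshold growth (`x₀(4) = 481`,
  `x₀(5,6,7) = 7^u`, `x₀(u) ≥ 13^u` numerically, `x₀(u)^{1/u} → ∞` proved in §H) is ARITHMETIC: (i) the
  `B`-adic ATOM — for `x < B^u` the powers `B^a` are `x^{1/u}`-rough, giving the integer top cells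
  `c_d(B)` of §H whose generating series has radius `1/B` (no smooth analogue: the `li`-measure has no
  atoms and its top cells at `(u, y = B)` tend to `0` super-exponentially in `u`); (ii) the PNT bias
  `li(t) − π(t) > 0` at small `t` (`20 %` at `t = 30`, `6 %` at `10³`): the bulk true cells are SMALLER
  than the `li`-cells, by 6–28 % for `y ≈ 16–42` (`u = 4`, `x = 10⁶`: `A_2/A_2^{li} = 0.901`, `A_3/A_3^{li} = 0.724`;
  `u = 5`, `x = 7⁵ − 1`: true `(1936, 2044, 468, 32)` — NOT real-rooted — against `li` `(1959, 2364, 516,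
  10.0)` — real-rooted; the top cell `32 = c_1(7)` is the atom). The exact law of `Q(u) = x₀(u)^{1/u}`
  therefore lives in the combinatorics of `c_d(B)` (first failing stabilised Newton/Maclaurin window
  `m(B)`: `1` for `B ≤ 13`, `2` for `B = 17, 19`, gen-3 tables) and in prime-gap statistics just above `B`,
  not in analysis; it has no bearing on the (now proved) crux and is left there.
* LANDING (this cycle): §I as `Theorems/ModelHyperbolicity/Negative/ModelHyperbolicityWindowCone.lean`
  (`--supports stmt-Parity-14110`; id in the seat NOTES / item evidence); numerics report
  `numerics_cycle3_limodel.md` attached as item evidence. FINAL STATE OF THE NEGATIVE SIDE: §A, §E, §F,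
  §B/§C, §G, §H landed (parts 1–7, p70990 … p75605 + ThresholdGrowth), §I this cycle; 0 sorries; no
  `-- Targets` were ever filed (the lead had no stuck stub).

## VERDICT (cycle 2, gen-3 seat, 2026-08-16): STILL NO KILL — crux all but proved; new theorem on the NEGATIVE side

State read at cycle start: line `window-chain-transport` picked; SIX of its seven stubs are ACCEPTED in
`Theorems/LeeYangFibresModelHyperbolicity{Defs,CellLimit,WindowChain,SimpleZeros,Transfer,Calculus}.lean`
(p72868, p73354, p73419, p73603, p73686, p73967) — in particular the whole MODEL HALF (window chain ⇒
real SIMPLE zeros of `G(u;·)` for every integer `u ≥ 2`) and the transfer are kernel-checked; only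
`stub_cellRate : DensityCalculus → CellRate` (Alladi's cell asymptotics with rate `O_{j,k}(X/log² Y)` on
`log X ≤ k log Y`) is open. ADVERSARIAL READ of `CellRate` (this seat, independent of drefute's audit):
TRUE as typed — `j = 0` is PNT with de la Vallée Poussin's error plus `π(Y) − Y/log Y = O(Y/log² Y) ≤
O(X/log² Y)`; for `j ≥ 1` the error recursion `Σ_{Y ≤ p ≤ X^{1/2}} X/(p log²(X/p)) ≤ 4X/log² X · Σ 1/p`
stays `O_k(X/log² X)` exactly BECAUSE `Σ_{Y≤p≤√X} 1/p = log(u/2) + O(1/log Y)` and `u ≤ k` (drop the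
`k`-restriction and the constant cannot exist: `log log X` growth); the secondary term `−[j=0]·Y/log Y`
is needed only at `j = 0` (at `j = 1` the `−Σ_p π(p)` contribution is `≍ X/log² X`, absorbed); the
densities `I_{j+1}(u) = ∫_1^{u−1} I_j(t) dt/t` match the Buchstab recursion `Φ_{j+1}(X,Y) =
Σ_{p ≥ Y} Φ_j(X/p, p)` (substitution `p = X^{1/v}`, `dπ(p)/p ≈ −dv/v`). So no stub is attackable and
the crux itself has no counterexample: what is left for a disprover is the QUANTITATIVE negative side.
* NEW THEOREM (§H, sorry-free, standard axioms; gen-2's conjecture "x₀(u)^{1/u} → ∞" PROVED):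
  for every `B` there is `u₀` such that for all `u ≥ u₀` every admissible threshold has `x₀(u) ≥ B^u`
  (`threshold_ge_pow`); for prime `B`, `¬ RealRootedAt u (B^u − 1)` for all large `u`
  (`not_realRootedAt_prime_pow_sub_one`); the natural strengthening "`x ≥ B^u` suffices for all `u`"
  (`ModelHyperbolicityExpThreshold`, which the exact data `x₀(5) = 7^5, x₀(6) = 7^6, x₀(7) = 7^7`
  invites) is FALSE (`not_modelHyperbolicityExpThreshold`), though it implies the crux. The proof needs
  NO prime number theory: (i) MACLAURIN OBSTRUCTION `not_realRootedAt_of_maclaurin` — with top cell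
  `A_D > 0`, real-rootedness forces `m!·A_{D−m}·A_D^{m−1} ≤ A_{D−1}^m` for all `2 ≤ m ≤ D−1` (zeros real
  and `≤ 0` since coefficients `≥ 0`; Vieta; `m!·e_m(a) ≤ e_1(a)^m`), the family of which §G is `m = 2`;
  (ii) at `x = B^u − 1` the cell `A_{u−2}` is bounded UNIFORMLY in `u` by `B^{B³+1}`
  (`cell_prime_pow_sub_one_le`: strip the `B`-part, the cofactor has all primes `≥ B+1` and
  `(B+1)^{Ω} ≤ m < B^{Ω+2}` forces `Ω < B³`; `n ↦ cofactor` is injective on the cell), while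
  `A_{u−1}, A_{u−1−m} ≥ 1` (`B^{u−1}, B^{u−1−m}`); (iii) `m! > (B^{B³+1})^m` for some `m`
  (`exists_pow_lt_factorial`). Conceptually: the stabilised top cells `c_d(B) = #{m : p∣m ⇒ p > B,
  m < B^{Ω(m)+d}}` count Beurling-type generalised integers of additive weight `Σ_{p^a‖m} a·log_B(p/B) < d`,
  so `Σ_d c_d(B) s^d` has radius `1/B`, while coefficientwise limits of real-rooted polynomials with
  non-negative coefficients and bounded `c_2/c_1` are ENTIRE (Laguerre–Pólya) — some Maclaurin/Newton
  window must fail for every `B`. NUMERICS (this seat, num/stabilised_cells.py, stdlib DFS with bulk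
  prime counting, sieve `1.5·10⁸`): `c_d(B)`, `d ≤ 6`: `B=2: 2,7,15,37,84,187`; `3: 4,17,78,310,1179,4356`;
  `5: 15,182,1763,14757,114511,836809`; `7: 32,722,12329,176125,2251049,26629104`;
  `11: 402,29202,1247122,40672419,1119054961,27345812695`; `d ≤ 4`: `13: 461,47696,2820952,124307866`,
  `17: 3492,795301,89117380,6920675225`, `19: 2505,728674,102503279,9861096646` (all of gen-2's values
  reproduced) — for every `B ≤ 13`, EVERY Maclaurin index `m ≥ 2` and EVERY asymptotic Newton window
  `c_{i+1}² ≥ (1+1/i)·c_i·c_{i+2}` in range FAILS; `B = 17`: Maclaurin `m = 2` holds, `m = 3` fails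
  (`5.063e17 > 5.030e17`), Newton window `2` fails; `B = 19`: Maclaurin `m = 2, 3` hold, Newton window `2`
  fails (`1.051e16 < 1.078e16`); `d ↦ c_d(B)` itself stays (mostly) log-concave. So the stabilised top of
  `P_{u,B^u−1}` is not real-rooted for every prime `B ≤ 19` already by windows of index `≤ 3`. The true threshold is believed to be
  `x₀(u) = Q(u)^u`, `Q(u) ~ (u/e)²` (gen-1 fit); this seat's theorem gives only `Q(u) → ∞`. Remark for
  the route: threshold growth does NOT obstruct AbsoluteUpgrade's hope (hyperbolicity at `x = N` for `u`
  up to `≍ √(log log N)`): even `Q(u) ~ (u/e)²` allows `u ≍ log N / (2 log log N)`.)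
* OPEN (quantitative only, no bearing on the crux's truth or on the accepted ineffective transfer): is
  `log x₀(u)` of order `u log u` (granularity-governed: the regime-end law `Q(u)^u`, which all exact data
  `u ≤ 12` follow) or of order `e^{cu}` (conditioning-governed)? Near the locked zeros `−1, −2, …, −K`,
  `K ≈ 0.37u`, the model polynomial cancels to relative size `≈ e^{−1.5u}` (gen-1: certificate
  conditioning `10^{−0.40u}`), so the finite-`x` sign pattern there survives only if the `1/log x`
  corrections `A_j(x)·log x/x − I_j(u)` are COHERENT in `j` (e.g. a smooth reparametrisation
  `u ↦ u + a/log x`, `x/log x ↦ li`-type terms, which moves zeros but keeps them real); incoherent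
  relative errors of size `C/log x` would force `log x₀(u) ≳ e^{cu}`. Arithmetic irregularities are
  `O(exp(−c√log x))` and only force `log x₀(u) ≳ u²`. Untestable by exact cells (needs `u ≳ 15`,
  `x ≳ 10¹⁶`); a second-order Alladi expansion `A_j = (x/log x)(I_j + I_j^{(1)}/log x + …)` would decide it.
* LANDING: part 6 `Theorems/ModelHyperbolicity/Negative/ModelHyperbolicityMaclaurin.lean` (§H1–§H2,
  p75605 ACCEPTED) and part 7 `…/ModelHyperbolicityThresholdGrowth.lean` (§H3–§H4),
  `--supports stmt-Parity-14110`.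

## VERDICT (cycle 1 of this seat): RESISTS — and a complete proof ROUTE now exists on paper

No loophole in the typing (gen-1 + rattack + this seat: coercions fine, `x₀` may depend on `u`,
`u : ℕ`). With `A_j(x) ~ I_j(u)·x/log x` (`1 ≤ j ≤ u−1`, fixed `u`; Alladi/Buchstab, classical) the crux
at an integer `u ≥ 4` is EQUIVALENT to: the limit polynomial `G(u;t) = Σ_{j=1}^{u−1} I_j(u) t^{j−1}`
(`I_1 = 1`, `I_j(u) = ∫_j^u I_{j−1}(v−1) dv/(v−1)`, `I_j ≡ 0` on `u ≤ j`) has only real SIMPLE zeros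
(simple real zeros persist under coefficient perturbation; a non-real pair persists too; transfer
to finite `x` by sign alternation at `u − 1` fixed points, `realRootedAt_of_alternating` in §F).
* Real-rootedness of `G(u;·)` for EVERY real `u > 1` is a theorem on paper (rattack finding, re-derived):
  `G(u;z) = Σ_N z^N Z_N(u)`, `Z_N(u) = ∫_{1≤t₁, tᵢ+1≤tᵢ₊₁, t_N≤u−1} ∏ dtᵢ/tᵢ` is the grand partition
  function of 1-D hard rods on `[1,u−1]` with activity `dt/t`; its lattice discretisations are weighted
  independence polynomials of unit-interval (claw-free) graphs ⇒ real-rooted (Chudnovsky–Seymour 2007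
  + clique substitution), and `m → ∞` + Hurwitz. So the planner's kill route "a complex pair at some
  large u" is DEAD; gen-1 certified SIMPLE real zeros for every integer `u ≤ 500` (320-digit Taylor
  models), this seat re-checked `u ≤ 30` in floats (num/gaplemma.py).
* NEW (this seat, paper proof, checked numerically): SIMPLICITY — the one piece every previous note called
  open — follows from an elementary GAP LEMMA by a continuity/squeeze argument which gives
  real-rootedness at the same time (no hard rods needed). This vindicates crux idea card
  `delay-sturm-interlacing` (ideator 2); details, because the lead/provers should build on it:
  - GAP LEMMA. Fix `z < 0`, `g(w) := G(w;z)`: `g = 1` on `(1,2]`, `g ∈ C⁰(1,∞) ∩ C¹(2,∞)`,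
    `g'(w) = z·g(w−1)/(w−1)` (`w > 2`). Then two zeros of `g` in `(2,∞)` are MORE than `1` apart.
    Proof: `g(2) = 1`, so the zero set `Z ⊂ (2,∞)` is finite on bounded sets (on each `[n,n+1]`, `g` is
    the restriction of a function analytic near `[n,n+1]` — only `I_j`, `j ≤ n`, enter, each analytic
    off `(−∞, j−1]` — and `g ≢ 0` there, else `g' = z g(·−1)/(·−1)` propagates `g ≡ 0` down to `(1,2)`).
    If `a < b` are consecutive zeros with `b − a ≤ 1`, `g` has one sign on `(a,b)` and
    `0 = g(b) − g(a) = z ∫_a^b g(w−1) dw/(w−1)` forces a zero `c ∈ (a−1, b−1)`, `c < b−1 ≤ a`,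
    `a − c < 1`; the consecutive pair `(max Z∩[c,a), a)` is again within distance `< 1` with right end
    `a < b`: iterating gives an infinite strictly decreasing sequence in the finite set `Z ∩ (2,b]`. ∎
    (num/gaplemma.py: min gap 2.44, 1.97, 1.66, 1.43, 1.33, 1.18, 1.05 at z = −3.08, −5, −9.41, −20,
    −32.1, −100, −1000 on (2,40]; the bound `1` is sharp as `z → −∞`.)
  - INTERLACING by continuity in `u`. Invariant 𝓘(u): all zeros of `G(u;·)` (`z₁ > … > z_d`,
    `d = ⌈u⌉−2`) and of `G(u−1;·)` (`w₁ > … > w_{d−1}`) are real, simple and `z₁ > w₁ > z₂ > … > w_{d−1} > z_d`.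
    (i) 𝓘 holds for `u ∈ (3, 3+ε)`: `G(u;t) = 1 + log(u−1)·t + I₃(u)t²`, `G(u−1;t) = 1 + log(u−2)·t`,
    `z₁ → −1/log 2`, `w₁ = −1/log(u−2) ~ −1/(u−3)`, `z₂ ~ −log 2/I₃(u) ~ −c/(u−3)²`.
    (ii) On `(k,k+1)` degrees are constant, sorted zeros move continuously, and the first failure time
    `U` would exhibit an equality `zᵢ = wᵢ` or `wᵢ = zᵢ₊₁` in the limit chain (a collision `zᵢ = zᵢ₊₁`
    squeezes `wᵢ`; zeros cannot leave ℝ without colliding first) — i.e. a common zero `ζ < 0` of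
    `G(U;·)` and `G(U−1;·)`: then `w ↦ G(w;ζ)` vanishes at `U−1` and `U`, distance `1`, contradicting
    the Gap Lemma (`U > 3`). Same at `u = k` itself.
    (iii) Births at `u = k⁺`: `G(u;·)` gains the zero `z_new ≈ −I_{k−1}(k)/I_k(u) ≍ −(u−k)^{−(k−1)}`,
    `G(u−1;·)` gains `w_new ≍ −(u−k)^{−(k−2)}`, so `z_new < w_new < (old zeros)` and 𝓘 persists; the
    new zero is real because the `k−2` old simple real zeros persist and non-real zeros come in pairs.
    Hence 𝓘(u) for all `u > 3`: `G(u;·)` has only real SIMPLE zeros for every real `u > 2`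
    (checked: interlacing exact in floats for `u ≤ 14`; beyond, the locked zeros at `−1,−2,…` of
    consecutive `u` agree to `< 10⁻¹⁵` — gen-1/ideator-2 verified strictness at 80 digits to `u = 36`;
    the proof needs no margin).
  - TRANSFER (S4): `A_j(x)·log x/x → I_j(u)` for `1 ≤ j ≤ u−1` (induction on `j` over the tree's
    Buchstab machinery `RoughNumbersBuchstab.lean`, `BuchstabFunction.lean`; PNT) ⇒ for `x ≥ x₀(u)` the
    reduced polynomial alternates in sign at `u−1` fixed rational points separating the simple zeros of
    `G(u;·)` ⇒ `RealRootedAt u x` by `realRootedAt_of_alternating` (§F, sorry-free here).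
  So every step of a proof of the crux is now "provable-now" mathematics; what a refutation would
  need — an exact double zero of `G(u;·)` at an integer `u` with unfavourable splitting — is excluded
  by the Gap Lemma. I therefore rate the crux TRUE (sketch level) and spend the seat's Lean on the
  quantitative NEGATIVE side (how large `x₀(u)` must be) and on prover-facing tools.

## What is PROVED in this file (all sorry-free, standard axioms; §A and §E also LANDED as
## `Theorems/ModelHyperbolicity/Negative/ModelHyperbolicityLoadBearing.lean` (p70990, accepted) and
## `…/ModelHyperbolicityUniformFalse.lean` (p71402))
* §A LOAD-BEARING: `2 ≤ u` (`u = 0, 1`: zero polynomial at every `x` — `not_realRootedAt_zero/one`,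
  `modelHyperbolicity_false_without_two_le`); the `x₀`-guard (`cellPoly_eight`: `P_{u,8} = 4z+2z²+z³ =
  z((z+1)²+3)` for EVERY `u ≥ 4`, `not_realRootedAt_eight`, `modelHyperbolicity_false_without_largeX`).
* §E QUANTIFIER ORDER (gen-1's only `sorry`, E1, now closed): `¬ ModelHyperbolicityUniform`
  (`∃ x₀ ∀ u` is false) and `not_realRootedAt_two_pow_pred : ∀ u ≥ 6, ¬ RealRootedAt u (2^(u−1))`, i.e.
  `x₀(u) > 2^{u−1}`: at `x = 2^k, u = k+1` the top Landau cells are `1, 2, 7` for all `k ≥ 5`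
  (`card_lset_top`, doubling bijection `lset_succ_eq_image` behind the wall `2^{k+1} < 3^{k−1}`, base
  `x = 32` by the `Nat.primeFactorsList_ofNat` simproc), and Vieta + Newton give `Σ r² = 2² − 2·7 < 0`.
* §F PROVER-FACING TOOLS: integer threshold `threshold_lt_minFac_iff_le` / `cell_eq_of_window`
  (`(B−1)^u ≤ x < B^u ⇒ (x^{1/u} < P⁻(n) ↔ B ≤ P⁻(n))`, making every concrete cell a `simp`/`norm_num`
  computation), `cell_zero`, `cell_eq_zero_of_le`, `cellPolyQ`, `cellPoly_eq_mul_Q`,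
  `natDegree_cellPolyQ_le`, and the TRANSFER `realRootedAt_of_alternating` (IVT count
  `le_card_roots_of_alternating` + `im_eq_zero_of_natDegree_le_card_roots`), plus
  `realRootedAt_of_natDegree_le_one`.
* §B/§C: `realRootedAt_two`, `realRootedAt_three` (all `x ≥ 2`, Bertrand); non-monotonicity in `x`
  (`realRootedAt_four_26`, `not_realRootedAt_four_27`, `not_monotone_in_x`); (B2) the `u = 4` threshold
  pair: `not_realRootedAt_four_480` (`90,59,10`: discriminant `−119`) and `realRootedAt_four_481`
  (`Q = 10(t+3)²`, a DOUBLE zero) — kernel-clean (gen-1 had it by `native_decide`; `x₀(4) = 481`).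
  B2's raw cells cost ~40 s each to elaborate (480-term unrolling), so B2 is kept OUT of this workfile:
  it is `Theorems/ModelHyperbolicity/Negative/ModelHyperbolicityThresholdFour.lean` (part 5) and the
  seat-folder file `Disproof_full_with_B2.lean`.
* §G REUSABLE NEGATIVE CRITERION `not_realRootedAt_of_top_cells`: top cell `A_D > 0`, `D ≥ 3`,
  `(D−2)·A_{D−1}² < 2(D−1)·A_D·A_{D−2}` ⇒ `¬ RealRootedAt u x` (Cauchy–Schwarz on the real zeros of
  `Q` + Vieta + Newton; `D = 3` is the discriminant). Instances: `x = 8` (all `u ≥ 4`), `x = 480`,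
  the `7,2,1` pattern of E1; and it is the mechanism of the `x = B^u − 1` failures in the table below.
* §H THRESHOLD GROWTH (gen-3 seat): `not_realRootedAt_of_maclaurin` (Maclaurin obstruction, all
  `m`), `card_roots_eq_natDegree_of_im_eq_zero` (a real polynomial with only real complex zeros splits
  over `ℝ`), `cell_prime_pow_sub_one_le` (`A_{u−2}(B^u−1) ≤ B^{B³+1}`), `exists_pow_lt_factorial`,
  `not_realRootedAt_prime_pow_sub_one`, `threshold_ge_pow` (`x₀(u) ≥ B^u` eventually, every `B`),
  `not_modelHyperbolicityExpThreshold`.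
* §I WINDOW CONE (gen-4 seat): `sector_functional_pos`, `modelEval_conj`,
  `window_combination_ne_zero_of_chain` (under `WindowChain N`) and the unconditional
  `window_combination_ne_zero` (via the landed `stub_windowChain stub_calculus`): non-negative finite
  combinations of `G_N(v;·)`, `v` in a unit window `[a, a+1] ⊆ [1, N]`, have no zeros off `ℝ`; the
  INTEGRAL form `window_integral_ne_zero(_of_chain)`: `∫_a^{a+1} w(v) G_N(v;z) dv ≠ 0` for `Im z ≠ 0` and
  every weight `w` continuous and positive on `[a, a+1]` (so `∫_{u−1}^u y^v G(v;t) dv/v` is real-rooted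
  for every `y > 0`).
* LANDED: parts 1–5 ACCEPTED (p70990 `…LoadBearing`, p71402 `…UniformFalse`, p72178 `…NotMonotone` =
  §F+§B+§C, p73671 `…TopCellObstruction` = §G, p73885 `…ThresholdFour` = B2); parts 6–7 (§H) being
  submitted by the gen-3 seat (ids in the seat NOTES / item evidence). Also evidence `StubTransfer.lean`: the line `delay-ladder-sturm-chain`'s `stub_transfer`
  proved verbatim from part 3 (`stub_transfer_proof`).

## NUMERICS (stdlib, reproducible in the seat folder; gen-1's certified tables stand)
* num/topcells.py — stabilised top cells at `x = B^u − 1`, `c_d(B) = #{m : P⁻(m) > B, m < B^{Ω(m)+d}}`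
  (`= A_{u−d}(B^u−1)` once `u ≥ u₀(B)`): `B=2: (2,7,15,37)`, `3: (4,17,78,310)`, `5: (15,182,1763,14757)`,
  `7: (32,722,12329,176125)`, `11: (402,29202,1247122,40672419)`, `13: (461,47696,2820952,124307866)`;
  in every case `c₂² < 2c₁c₃` (`p₂ = e₁² − 2e₂ = −2.75, −20.9, −87.8, −261, −928, −1534`), so `P_{u,B^u−1}` is
  NOT real-rooted for all large `u` and `x₀(u) ≥ 13^u` eventually (gen-1: `x₀(4)=481`, `x₀(5,6,7) = 7^u`,
  heuristic `x₀(u) = Q(u)^u`, `Q ~ (u/e)²`). num/topcells2-3.py (sieve + π-lookups): at `B = 17, 19` the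
  top-THREE window PASSES (`17: (3492,795301,89117380,6920675225)`, `19: (2505,728674,102503279,
  9861096646)`, `c₂² > 2c₁c₃`) but the next asymptotic Newton window FAILS (`c₃² < (3/2)c₂c₄`), so
  `P_{u,17^u−1}`, `P_{u,19^u−1}` are still not real-rooted for all large `u` (gen-1 saw them pass at
  `u = 8, 9, 10`: not yet stabilised there); `B = 23`: `(7008,3753732,870522462,·)`, top-three passes, `c₄`
  not computed. Conjecture (gen-2): for every `B` some stabilised Newton window fails, i.e. `x₀(u)^{1/u} → ∞`
  — PROVED in §H (gen-3) via the Maclaurin window at a large index, with no cell computation at all.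
  First failing MACLAURIN index `m` (`m!·c_{m+1}·c_1^{m−1} > c_2^m`) from these tables: `m = 2` for
  `B ≤ 13`; `B = 17`: `m = 3` (`6·6920675225·3492² = 5.06e17 > 795301³ = 5.03e17`); `B = 19`: `m ≥ 4`
  (index 3 holds: `3.71e17 < 3.87e17`, although gen-2's sharper Newton window 3 already fails there).
* num/gaplemma.py — Gap Lemma and interlacing checks quoted above; zeros of `G(u;·)`, `u ≤ 30`,
  real and `= degree` in number; `min zᵢ₊₁/zᵢ = 6.03, 2.82, 2.22, …, 1.115` at `u = 4, 5, 6, …, 30`.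
* num/limodel.py (+ scan2.py, scan_win.py, refine_thr.py, validate_cells.py; gen-4 seat) — `I_j` on unit
  intervals as 96-term Taylor models at 110 digits (reproduces `Σ_j I_j(u) − e^{−γ}u = 4.9·10⁻¹⁶` at
  `u = 12` and gen-2's zero ratios `6.032, 2.822, 2.219, …, 1.115, …, 1.100` for `u ≤ 34`), `li`-cells by
  the superposition identity (moments `∫ h^n y^h dh`), real-rootedness by certified sign-change counting
  on `t < 0` with refinement of near-double zeros; tables (I-a)–(I-c) above; full report attached to the
  item as `numerics_cycle3_limodel.md`.

## Seat bookkeeping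
gen-1's 70 KB Disproof.lean (123 theorems, native_decide cells at x ≤ 823543, B2–B5: `x₀(4)=481`,
failures at `7^u−1` for `u=5,6,7`) lives in run/gate/evidence, which is not mounted in this seat's jail;
this file was REBUILT from the evidence notes (same names where known) and supersedes it as the crux
workfile. No `-- Targets`: the lead has filed no stuck stubs (cycle 2: 6/7 stubs accepted, `stub_cellRate`
in progress, payload `stuck_stubs = []`).
-/

namespace Summit.Parity.GeneralizedHardyLittlewood.Cruxes.ModelHyperbolicity.Disproof

open Summit.Parity.GeneralizedHardyLittlewood.Theses.LeeYangFibres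
open Finset Polynomial
open scoped Classical Nat

/-! ## §0 The crux, factored -/

/-- The rough-integer cell `A_j(x)` at roughness `u`: the number of `n ≤ x` all of whose prime
factors exceed `x^{1/u}` and with exactly `j` prime factors counted with multiplicity. -/
noncomputable def cell (u x j : ℕ) : ℕ :=
  ((Finset.Icc 1 x).filter (fun n => (x : ℝ) ^ ((1 : ℝ) / u) < (Nat.minFac n : ℝ) ∧
    ArithmeticFunction.cardFactors n = j)).card

/-- The cell polynomial `P_{u,x}(z) = Σ_{j ≤ u} A_j(x) z^j`. -/
noncomputable def cellPoly (u x : ℕ) (z : ℂ) : ℂ :=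
  ∑ j ∈ Finset.range (u + 1), (cell u x j : ℂ) * z ^ j

/-- "`P_{u,x}` has only real zeros". -/
def RealRootedAt (u x : ℕ) : Prop := ∀ z : ℂ, cellPoly u x z = 0 → z.im = 0

/-- The crux, verbatim, in the factored notation (definitional). -/
theorem crux_iff : ModelHyperbolicity ↔ ∀ u : ℕ, 2 ≤ u → ∃ x₀ : ℕ, ∀ x : ℕ, x₀ ≤ x → RealRootedAt u x :=
  Iff.rfl

/-! ## §1 Elementary lemmas on the threshold `x^{1/u}` and on `Ω` -/

/-- If `x < 2^u` (and `u > 0`) the roughness threshold is below `2`: every `n ≥ 2` is `x^{1/u}`-rough. -/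
theorem threshold_lt_two {x u : ℕ} (h : x < 2 ^ u) (hu : 0 < u) : (x : ℝ) ^ ((1 : ℝ) / u) < 2 := by
  rw [one_div, Real.rpow_inv_lt_iff_of_pos (Nat.cast_nonneg _) (by norm_num) (Nat.cast_pos.mpr hu),
    Real.rpow_natCast]
  exact_mod_cast h

theorem one_le_threshold {x : ℕ} (u : ℕ) (hx : 1 ≤ x) : (1 : ℝ) ≤ (x : ℝ) ^ ((1 : ℝ) / u) :=
  Real.one_le_rpow (by exact_mod_cast hx) (by positivity)

/-- Below `2^u` the cell predicate `x^{1/u} < P⁻(n)` just says `n ≥ 2`. -/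
theorem threshold_lt_minFac_iff {x u n : ℕ} (hx : 1 ≤ x) (h : x < 2 ^ u) (hu : 0 < u) (hn : 1 ≤ n) :
    (x : ℝ) ^ ((1 : ℝ) / u) < (Nat.minFac n : ℝ) ↔ 2 ≤ n := by
  constructor
  · intro hlt
    by_contra hn2
    have hn1 : n = 1 := by omega
    subst hn1
    rw [Nat.minFac_one, Nat.cast_one] at hlt
    exact absurd (one_le_threshold u hx) (not_le.mpr hlt)
  · intro hn2
    have hp : (Nat.minFac n).Prime := Nat.minFac_prime (by omega)
    calc (x : ℝ) ^ ((1 : ℝ) / u) < 2 := threshold_lt_two h hu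
      _ ≤ (Nat.minFac n : ℝ) := by exact_mod_cast hp.two_le

/-- `2^{Ω(n)} ≤ n` for `n ≠ 0`. -/
theorem two_pow_cardFactors_le {n : ℕ} (hn : n ≠ 0) : 2 ^ ArithmeticFunction.cardFactors n ≤ n := by
  rw [ArithmeticFunction.cardFactors_apply]
  conv_rhs => rw [← Nat.prod_primeFactorsList hn]
  exact List.pow_card_le_prod _ _ fun p hp => (Nat.prime_of_mem_primeFactorsList hp).two_le

/-- `3^{Ω(n)} ≤ n` for odd `n`. -/
theorem three_pow_cardFactors_le_of_odd {n : ℕ} (hn : Odd n) :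
    3 ^ ArithmeticFunction.cardFactors n ≤ n := by
  have hn0 : n ≠ 0 := by rintro rfl; exact (Nat.not_odd_zero hn).elim
  rw [ArithmeticFunction.cardFactors_apply]
  conv_rhs => rw [← Nat.prod_primeFactorsList hn0]
  refine List.pow_card_le_prod _ _ fun p hp => ?_
  have hpp : p.Prime := Nat.prime_of_mem_primeFactorsList hp
  have hpn : p ∣ n := Nat.dvd_of_mem_primeFactorsList hp
  have hp2 : p ≠ 2 := by
    rintro rfl
    exact (Nat.not_even_iff_odd.mpr hn) (even_iff_two_dvd.mpr hpn)
  have := hpp.two_le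
  omega

/-- A cell above the dyadic ceiling is empty: if `x < 2^j` then `A_j(x) = 0` (any `n` with `Ω(n) = j`
has `n ≥ 2^j > x`). -/
theorem cell_eq_zero_of_lt {u x j : ℕ} (h : x < 2 ^ j) : cell u x j = 0 := by
  unfold cell
  rw [Finset.card_eq_zero, Finset.filter_eq_empty_iff]
  rintro n hn ⟨-, hj⟩
  rw [Finset.mem_Icc] at hn
  have := two_pow_cardFactors_le (n := n) (by omega)
  rw [hj] at this
  omega

/-- The Landau cell `#{2 ≤ n ≤ x : Ω(n) = j}` (no roughness condition). -/
def lset (x j : ℕ) : Finset ℕ := (Finset.Icc 1 x).filter (fun n => 2 ≤ n ∧ ArithmeticFunction.cardFactors n = j)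

/-- Below `2^u` the rough cells ARE the Landau cells. -/
theorem cell_eq_card_lset {x u : ℕ} (hx : 1 ≤ x) (h : x < 2 ^ u) (hu : 0 < u) (j : ℕ) :
    cell u x j = (lset x j).card := by
  unfold cell lset
  congr 1
  refine Finset.filter_congr fun n hn => ?_
  rw [Finset.mem_Icc] at hn
  rw [threshold_lt_minFac_iff hx h hu hn.1]

theorem lset_eq_empty_of_lt {x j : ℕ} (h : x < 2 ^ j) : lset x j = ∅ := by
  unfold lset
  rw [Finset.filter_eq_empty_iff]
  rintro n hn ⟨-, hj⟩
  rw [Finset.mem_Icc] at hn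
  have := two_pow_cardFactors_le (n := n) (by omega)
  rw [hj] at this
  omega

/-! ## §A Load-bearing hypotheses

(A2) `2 ≤ u` cannot be dropped: at `u = 1` (and `u = 0`) the cell polynomial vanishes identically for
every `x`, so `z = i` is a zero.  (A1) "for all large `x`" cannot be replaced by "for all `x ≥ 1`":
at `x = 8` the polynomial is `4z + 2z² + z³ = z((z+1)² + 3)` for EVERY `u ≥ 4`. -/

/-- At `u = 1` every cell is empty: `x < P⁻(n) ≤ n ≤ x` is impossible. -/
theorem cell_one_eq_zero (x j : ℕ) : cell 1 x j = 0 := by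
  unfold cell
  rw [Finset.card_eq_zero, Finset.filter_eq_empty_iff]
  rintro n hn ⟨hlt, -⟩
  rw [Finset.mem_Icc] at hn
  have h1 : (x : ℝ) ^ ((1 : ℝ) / ((1 : ℕ) : ℝ)) = x := by simp
  rw [h1] at hlt
  have : (Nat.minFac n : ℝ) ≤ n := by exact_mod_cast Nat.minFac_le (by omega)
  have : (n : ℝ) ≤ x := by exact_mod_cast hn.2
  linarith

theorem cellPoly_one (x : ℕ) (z : ℂ) : cellPoly 1 x z = 0 := by
  unfold cellPoly
  simp [cell_one_eq_zero]

/-- The crux with `u = 1` admitted is false. -/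
def ModelHyperbolicityWithoutTwoLe : Prop :=
  ∀ u : ℕ, ∃ x₀ : ℕ, ∀ x : ℕ, x₀ ≤ x → RealRootedAt u x

theorem modelHyperbolicity_false_without_two_le : ¬ ModelHyperbolicityWithoutTwoLe := by
  intro h
  obtain ⟨x₀, hx₀⟩ := h 1
  have := hx₀ x₀ le_rfl Complex.I (cellPoly_one x₀ _)
  simp at this

/-- At `u = 0` Lean reads `x ^ (1/0) = x ^ 0 = 1`, the only cell in `range 1` is `j = 0`, and
`Ω(n) = 0` forces `n = 1` with `P⁻(1) = 1`: again the zero polynomial. -/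
theorem cellPoly_zero (x : ℕ) (z : ℂ) : cellPoly 0 x z = 0 := by
  unfold cellPoly cell
  simp only [zero_add, Finset.range_one, Finset.sum_singleton, pow_zero, mul_one, Nat.cast_eq_zero,
    Finset.card_eq_zero, Finset.filter_eq_empty_iff]
  rintro n hn ⟨hlt, hj⟩
  rw [Finset.mem_Icc] at hn
  have hn1 : n = 1 := by
    rcases ArithmeticFunction.cardFactors_eq_zero_iff_eq_zero_or_one.mp hj with h | h <;> omega
  subst hn1
  simp at hlt

theorem not_realRootedAt_zero (x : ℕ) : ¬ RealRootedAt 0 x := fun h => by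
  simpa using h Complex.I (cellPoly_zero x _)

theorem not_realRootedAt_one (x : ℕ) : ¬ RealRootedAt 1 x := fun h => by
  simpa using h Complex.I (cellPoly_one x _)


/-! ### (A1) the `x₀`-guard is load-bearing: `x = 8` fails for every `u ≥ 4` -/

/-- No `n ≥ 2` has `Ω(n) = 0`. -/
theorem lset_zero (x : ℕ) : lset x 0 = ∅ := by
  unfold lset
  rw [Finset.filter_eq_empty_iff]
  rintro n - ⟨hn2, hΩ⟩
  rcases ArithmeticFunction.cardFactors_eq_zero_iff_eq_zero_or_one.mp hΩ with h | h <;> omega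

theorem card_lset_eight :
    (lset 8 1).card = 4 ∧ (lset 8 2).card = 2 ∧ (lset 8 3).card = 1 := by
  refine ⟨?_, ?_, ?_⟩ <;>
  · unfold lset
    rw [Finset.card_filter]
    simp [Finset.sum_Icc_succ_top, ArithmeticFunction.cardFactors_apply, Nat.primeFactorsList_ofNat]

/-- For every `u ≥ 4`: `P_{u,8}(z) = 4z + 2z² + z³`. -/
theorem cellPoly_eight (u : ℕ) (hu : 4 ≤ u) (z : ℂ) : cellPoly u 8 z = 4 * z + 2 * z ^ 2 + z ^ 3 := by
  unfold cellPoly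
  have hx : (8 : ℕ) < 2 ^ u := lt_of_lt_of_le (by norm_num) (Nat.pow_le_pow_right (by norm_num) hu)
  have hcell : ∀ j, cell u 8 j = (lset 8 j).card := cell_eq_card_lset (by norm_num) hx (by omega)
  simp_rw [hcell]
  obtain ⟨h1, h2, h3⟩ := card_lset_eight
  rw [← Finset.sum_subset (s₁ := ({1, 2, 3} : Finset ℕ))]
  · simp [Finset.sum_insert, h1, h2, h3]
    ring
  · intro j hj
    simp only [Finset.mem_insert, Finset.mem_singleton] at hj
    simp only [Finset.mem_range]
    omega
  · intro j _ hj
    simp only [Finset.mem_insert, Finset.mem_singleton, not_or] at hj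
    obtain ⟨hj1, hj2, hj3⟩ := hj
    rcases Nat.eq_zero_or_pos j with rfl | hj0
    · simp [lset_zero]
    · have hj4 : 4 ≤ j := by omega
      have : (8 : ℕ) < 2 ^ j := lt_of_lt_of_le (by norm_num) (Nat.pow_le_pow_right (by norm_num) hj4)
      simp [lset_eq_empty_of_lt this]

/-- (A1) For every `u ≥ 4`, `P_{u,8}` has the non-real zero pair `-1 ± i√3`. -/
theorem not_realRootedAt_eight (u : ℕ) (hu : 4 ≤ u) : ¬ RealRootedAt u 8 := by
  intro h
  obtain ⟨z, hz⟩ : ∃ z : ℂ, z ^ 2 + 2 * z + 4 = 0 := by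
    obtain ⟨z, hz⟩ := IsAlgClosed.exists_root (C 1 * X ^ 2 + C 2 * X + C 4 : ℂ[X])
      (by rw [Polynomial.degree_quadratic (by norm_num)]; norm_num)
    exact ⟨z, by simpa [IsRoot] using hz⟩
  have him : z.im = 0 := h z (by rw [cellPoly_eight u hu]; linear_combination z * hz)
  have hre : (z.re : ℂ) = z := Complex.ext rfl (by simp [him])
  rw [← hre] at hz
  norm_cast at hz
  nlinarith [sq_nonneg (z.re + 1)]

/-- The crux with the `x₀`-guard dropped (all `x ≥ 1`) — false. -/
def ModelHyperbolicityWithoutLargeX : Prop :=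
  ∀ u : ℕ, 2 ≤ u → ∀ x : ℕ, 1 ≤ x → RealRootedAt u x

theorem modelHyperbolicity_false_without_largeX : ¬ ModelHyperbolicityWithoutLargeX :=
  fun h => not_realRootedAt_eight 4 le_rfl (h 4 (by norm_num) 8 (by norm_num))

/-! ## §E Quantifier order: `x₀` cannot be uniform in `u` (gen-1's E1, now sorry-free)

Witness family `x = 2^k`, `u = k + 1` (`k ≥ 5`): the threshold `2^{k/(k+1)} < 2` makes every `n ≥ 2`
rough, the top three cells are `A_k = 1` (`2^k`), `A_{k-1} = 2` (`2^{k-1}, 3·2^{k-2}`),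
`A_{k-2} = 7` (`2^{k-5}·{8,12,18,20,27,28,30}`), stable under `k ↦ k+1` by the doubling bijection
`n ↦ 2n` (an odd `n` with `Ω(n) ≥ k-1` has `n ≥ 3^{k-1} > 2^{k+1}`).  For a monic real-rooted
polynomial `Σ r_i² = e₁² − 2e₂ = 2² − 2·7 = −10 < 0` is impossible. Hence `x₀(u) > 2^{u-1}` for all
`u ≥ 6`, and no `x₀` serves all `u`. -/

/-- `4·2^m < 3^m` for `m ≥ 4`. -/
theorem four_mul_two_pow_lt_three_pow (m : ℕ) (hm : 4 ≤ m) : 4 * 2 ^ m < 3 ^ m := by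
  induction m, hm using Nat.le_induction with
  | base => norm_num
  | succ m hm ih =>
    calc 4 * 2 ^ (m + 1) = 2 * (4 * 2 ^ m) := by ring
      _ < 2 * 3 ^ m := by omega
      _ ≤ 3 ^ (m + 1) := by rw [pow_succ]; omega

theorem two_pow_succ_lt_three_pow_pred {k : ℕ} (hk : 5 ≤ k) : 2 ^ (k + 1) < 3 ^ (k - 1) := by
  obtain ⟨m, rfl⟩ : ∃ m, k = m + 1 := ⟨k - 1, by omega⟩
  have := four_mul_two_pow_lt_three_pow m (by omega)
  rw [Nat.add_sub_cancel, show 2 ^ (m + 1 + 1) = 4 * 2 ^ m by ring]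
  exact this

/-- The doubling bijection: below the `3`-adic wall, `{n ≤ 2^{k+1} : Ω(n) = j+1} = 2·{m ≤ 2^k : Ω(m) = j}`. -/
theorem lset_succ_eq_image {k j : ℕ} (h3 : 2 ^ (k + 1) < 3 ^ (j + 1)) (hj : 1 ≤ j) :
    lset (2 ^ (k + 1)) (j + 1) = (lset (2 ^ k) j).image (fun m => 2 * m) := by
  ext n
  simp only [lset, Finset.mem_filter, Finset.mem_Icc, Finset.mem_image]
  constructor
  · rintro ⟨⟨hn1, hnle⟩, hn2, hΩ⟩
    have heven : Even n := by
      by_contra hodd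
      rw [Nat.not_even_iff_odd] at hodd
      have h3n := three_pow_cardFactors_le_of_odd hodd
      rw [hΩ] at h3n
      omega
    obtain ⟨m, rfl⟩ := heven
    have hm0 : m ≠ 0 := by omega
    have hΩm : ArithmeticFunction.cardFactors m = j := by
      have h2m : ArithmeticFunction.cardFactors (2 * m) = 1 + ArithmeticFunction.cardFactors m := by
        rw [ArithmeticFunction.cardFactors_mul two_ne_zero hm0,
          ArithmeticFunction.cardFactors_apply_prime Nat.prime_two]
      rw [two_mul] at h2m
      omega
    refine ⟨m, ⟨⟨by omega, ?_⟩, ?_, hΩm⟩, by omega⟩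
    · rw [pow_succ] at hnle
      omega
    · by_contra hm2
      have hm1 : m = 1 := by omega
      subst hm1
      simp at hΩm
      omega
  · rintro ⟨m, ⟨⟨hm1, hmle⟩, hm2, hΩm⟩, rfl⟩
    refine ⟨⟨by omega, ?_⟩, by omega, ?_⟩
    · rw [pow_succ]
      omega
    · rw [ArithmeticFunction.cardFactors_mul two_ne_zero (by omega),
        ArithmeticFunction.cardFactors_apply_prime Nat.prime_two, hΩm]
      ring

theorem card_lset_succ {k j : ℕ} (h3 : 2 ^ (k + 1) < 3 ^ (j + 1)) (hj : 1 ≤ j) :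
    (lset (2 ^ (k + 1)) (j + 1)).card = (lset (2 ^ k) j).card := by
  rw [lset_succ_eq_image h3 hj, Finset.card_image_of_injective _ (mul_right_injective₀ two_ne_zero)]

/-- Base case `x = 32`: `#{n ≤ 32 : Ω = 5} = 1`, `#{Ω = 4} = 2`, `#{Ω = 3} = 7`. -/
theorem card_lset_32 :
    (lset 32 5).card = 1 ∧ (lset 32 4).card = 2 ∧ (lset 32 3).card = 7 := by
  refine ⟨?_, ?_, ?_⟩ <;>
  · unfold lset
    rw [Finset.card_filter]
    simp [Finset.sum_Icc_succ_top, ArithmeticFunction.cardFactors_apply, Nat.primeFactorsList_ofNat]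

/-- The three top Landau cells at `x = 2^k` are `1, 2, 7` for every `k ≥ 5`. -/
theorem card_lset_top (k : ℕ) (hk : 5 ≤ k) :
    (lset (2 ^ k) k).card = 1 ∧ (lset (2 ^ k) (k - 1)).card = 2 ∧ (lset (2 ^ k) (k - 2)).card = 7 := by
  induction k, hk using Nat.le_induction with
  | base => exact card_lset_32
  | succ k hk ih =>
    obtain ⟨h0, h1, h2⟩ := ih
    refine ⟨?_, ?_, ?_⟩
    · rw [card_lset_succ (Nat.pow_lt_pow_left (by norm_num) (by omega)) (by omega), h0]
    · rw [show k + 1 - 1 = (k - 1) + 1 by omega, card_lset_succ ?_ (by omega), h1]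
      rw [show k - 1 + 1 = k by omega]
      exact lt_of_lt_of_le (two_pow_succ_lt_three_pow_pred hk) (Nat.pow_le_pow_right (by norm_num) (by omega))
    · rw [show k + 1 - 2 = (k - 2) + 1 by omega, card_lset_succ ?_ (by omega), h2]
      rw [show k - 2 + 1 = k - 1 by omega]
      exact two_pow_succ_lt_three_pow_pred hk

/-- The Landau cell polynomial at `x = 2^k` as an honest polynomial over `ℂ`. -/
noncomputable def LP (k : ℕ) : ℂ[X] :=
  ∑ j ∈ Finset.range (k + 2), C (((lset (2 ^ k) j).card : ℕ) : ℂ) * X ^ j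

theorem LP_coeff (k i : ℕ) :
    (LP k).coeff i = if i < k + 2 then (((lset (2 ^ k) i).card : ℕ) : ℂ) else 0 := by
  unfold LP
  rw [finsetSum_coeff]
  simp only [coeff_C_mul_X_pow]
  rw [Finset.sum_ite_eq]
  simp [Finset.mem_range]

theorem LP_eval (k : ℕ) (z : ℂ) :
    (LP k).eval z = ∑ j ∈ Finset.range (k + 2), (((lset (2 ^ k) j).card : ℕ) : ℂ) * z ^ j := by
  unfold LP
  rw [eval_finsetSum]
  simp only [eval_mul, eval_C, eval_pow, eval_X]

theorem cellPoly_eq_LP_eval (k : ℕ) (z : ℂ) : cellPoly (k + 1) (2 ^ k) z = (LP k).eval z := by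
  unfold cellPoly
  rw [LP_eval]
  refine Finset.sum_congr rfl fun j _ => ?_
  rw [cell_eq_card_lset Nat.one_le_two_pow (Nat.pow_lt_pow_right (by norm_num) (by omega)) (by omega)]

theorem LP_natDegree (k : ℕ) (hk : 5 ≤ k) : (LP k).natDegree = k := by
  apply natDegree_eq_of_le_of_coeff_ne_zero
  · rw [natDegree_le_iff_coeff_eq_zero]
    intro N hN
    rw [LP_coeff]
    split_ifs with hlt
    · have hN' : N = k + 1 := by omega
      subst hN'
      rw [lset_eq_empty_of_lt (Nat.pow_lt_pow_right (by norm_num) (by omega))]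
      simp
    · rfl
  · rw [LP_coeff, if_pos (by omega), (card_lset_top k hk).1]
    simp

theorem LP_leadingCoeff (k : ℕ) (hk : 5 ≤ k) : (LP k).leadingCoeff = 1 := by
  rw [leadingCoeff, LP_natDegree k hk, LP_coeff, if_pos (by omega), (card_lset_top k hk).1]
  simp

/-- Newton's identity `p₂ = e₁² − 2e₂` for a multiset. -/
theorem esymm_one_eq_sum {R : Type*} [CommRing R] (s : Multiset R) : s.esymm 1 = s.sum := by
  simp [Multiset.esymm, Multiset.powersetCard_one, Multiset.map_map]

theorem esymm_two_cons {R : Type*} [CommRing R] (a : R) (s : Multiset R) :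
    (a ::ₘ s).esymm 2 = s.esymm 2 + a * s.sum := by
  simp only [Multiset.esymm]
  rw [show (2 : ℕ) = 1 + 1 from rfl, Multiset.powersetCard_cons, Multiset.map_add, Multiset.sum_add,
    Multiset.map_map, Multiset.powersetCard_one, Multiset.map_map]
  congr 1
  simp only [Function.comp_def, Multiset.prod_cons, Multiset.prod_singleton]
  rw [Multiset.sum_map_mul_left, Multiset.map_id']

theorem sum_map_sq_eq {R : Type*} [CommRing R] (s : Multiset R) :
    (s.map (fun r => r ^ 2)).sum = s.sum ^ 2 - 2 * s.esymm 2 := by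
  induction s using Multiset.induction_on with
  | empty => simp [Multiset.esymm]
  | cons a s ih =>
    rw [Multiset.map_cons, Multiset.sum_cons, Multiset.sum_cons, esymm_two_cons, ih]
    ring

theorem re_multiset_sum (s : Multiset ℂ) : s.sum.re = (s.map Complex.re).sum := by
  induction s using Multiset.induction_on with
  | empty => simp
  | cons a s ih => simp [ih]

/-- E1: `P_{k+1, 2^k}` has a non-real zero for every `k ≥ 5` (so `x₀(u) > 2^{u-1}` for `u ≥ 6`). -/
theorem not_realRootedAt_succ_two_pow (k : ℕ) (hk : 5 ≤ k) : ¬ RealRootedAt (k + 1) (2 ^ k) := by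
  intro hreal
  obtain ⟨-, h1, h2⟩ := card_lset_top k hk
  have hdeg := LP_natDegree k hk
  have hlead := LP_leadingCoeff k hk
  have hroots : (LP k).roots.card = (LP k).natDegree := IsAlgClosed.card_roots_eq_natDegree
  have hv1 := coeff_eq_esymm_roots_of_card hroots (show k - 1 ≤ (LP k).natDegree by omega)
  have hv2 := coeff_eq_esymm_roots_of_card hroots (show k - 2 ≤ (LP k).natDegree by omega)
  rw [hdeg, hlead, LP_coeff, if_pos (by omega), h1, show k - (k - 1) = 1 by omega] at hv1
  rw [hdeg, hlead, LP_coeff, if_pos (by omega), h2, show k - (k - 2) = 2 by omega] at hv2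
  have he1 : (LP k).roots.sum = -2 := by
    rw [← esymm_one_eq_sum]
    push_cast at hv1
    linear_combination hv1
  have he2 : (LP k).roots.esymm 2 = 7 := by
    push_cast at hv2
    linear_combination -hv2
  -- every root is real
  have hP0 : LP k ≠ 0 := fun h => by rw [h, natDegree_zero] at hdeg; omega
  have him : ∀ r ∈ (LP k).roots, r.im = 0 := fun r hr =>
    hreal r (by rw [cellPoly_eq_LP_eval]; exact (mem_roots hP0).mp hr)
  -- Newton: Σ r² = e₁² - 2 e₂ = 4 - 14 = -10
  have hN := sum_map_sq_eq (LP k).roots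
  rw [he1, he2] at hN
  -- but Σ r² = Σ (re r)² ≥ 0
  have hre : ((LP k).roots.map (fun r => r ^ 2)).sum.re = ((LP k).roots.map (fun r => r.re ^ 2)).sum := by
    rw [re_multiset_sum, Multiset.map_map]
    congr 1
    refine Multiset.map_congr rfl fun r hr => ?_
    simp only [Function.comp_apply, sq, Complex.mul_re, him r hr]
    ring
  have hnonneg : 0 ≤ ((LP k).roots.map (fun r => r.re ^ 2)).sum :=
    Multiset.sum_nonneg fun x hx => by
      obtain ⟨r, -, rfl⟩ := Multiset.mem_map.mp hx
      positivity
  rw [hN] at hre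
  norm_num at hre
  linarith

/-- "`x₀` uniform in `u`": the crux with `∃ x₀` pulled in front of `∀ u`. -/
def ModelHyperbolicityUniform : Prop :=
  ∃ x₀ : ℕ, ∀ u : ℕ, 2 ≤ u → ∀ x : ℕ, x₀ ≤ x → RealRootedAt u x

theorem modelHyperbolicity_of_uniform : ModelHyperbolicityUniform → ModelHyperbolicity :=
  fun ⟨x₀, h⟩ u hu => ⟨x₀, h u hu⟩

/-- E1 (gen-1's only `sorry`, closed): no `x₀` serves every `u`. -/
theorem not_modelHyperbolicityUniform : ¬ ModelHyperbolicityUniform := by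
  rintro ⟨x₀, h⟩
  have hk : 5 ≤ max x₀ 5 := le_max_right _ _
  refine not_realRootedAt_succ_two_pow (max x₀ 5) hk (h _ (by omega) _ ?_)
  exact le_trans (le_max_left _ _) (Nat.lt_two_pow_self).le

/-- Quantitative form: the crux's threshold satisfies `x₀(u) > 2^{u-1}` for every `u ≥ 6`. -/
theorem not_realRootedAt_two_pow_pred (u : ℕ) (hu : 6 ≤ u) : ¬ RealRootedAt u (2 ^ (u - 1)) := by
  have := not_realRootedAt_succ_two_pow (u - 1) (by omega)
  rwa [show u - 1 + 1 = u by omega] at this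


/-! ## §F Prover-facing tools: integer form of the threshold, top cells vanish, and the TRANSFER
`sign alternation of the reduced real cell polynomial at u − 1 points ⇒ RealRootedAt u x` -/

/-- INTEGER THRESHOLD: if `(B-1)^u ≤ x < B^u` then `x^{1/u} < P⁻(n) ↔ B ≤ P⁻(n)`. -/
theorem threshold_lt_minFac_iff_le {x u B : ℕ} (hlo : (B - 1) ^ u ≤ x) (hhi : x < B ^ u) (hu : 0 < u)
    (n : ℕ) : (x : ℝ) ^ ((1 : ℝ) / u) < (Nat.minFac n : ℝ) ↔ B ≤ Nat.minFac n := by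
  have hu' : (0 : ℝ) < (u : ℝ) := Nat.cast_pos.mpr hu
  have h1 : (x : ℝ) ^ ((1 : ℝ) / u) < B := by
    rw [one_div, Real.rpow_inv_lt_iff_of_pos (Nat.cast_nonneg _) (Nat.cast_nonneg _) hu',
      Real.rpow_natCast]
    exact_mod_cast hhi
  have h2 : ((B - 1 : ℕ) : ℝ) ≤ (x : ℝ) ^ ((1 : ℝ) / u) := by
    rw [one_div, Real.le_rpow_inv_iff_of_pos (Nat.cast_nonneg _) (Nat.cast_nonneg _) hu',
      Real.rpow_natCast]
    exact_mod_cast hlo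
  constructor
  · intro h
    have : ((B - 1 : ℕ) : ℝ) < Nat.minFac n := lt_of_le_of_lt h2 h
    have : B - 1 < Nat.minFac n := by exact_mod_cast this
    omega
  · intro h
    exact lt_of_lt_of_le h1 (by exact_mod_cast h)

/-- With an integer threshold the cell is a decidable count: `A_j(x) = #{n ≤ x : B ≤ P⁻(n), Ω(n) = j}`. -/
theorem cell_eq_of_window {x u B : ℕ} (hlo : (B - 1) ^ u ≤ x) (hhi : x < B ^ u) (hu : 0 < u) (j : ℕ) :
    cell u x j = ((Finset.Icc 1 x).filter (fun n => B ≤ Nat.minFac n ∧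
      ArithmeticFunction.cardFactors n = j)).card := by
  unfold cell
  congr 1
  exact Finset.filter_congr fun n _ => by rw [threshold_lt_minFac_iff_le hlo hhi hu]

/-- `P⁻(n)^{Ω(n)} ≤ n` for `n ≠ 0`. -/
theorem minFac_pow_cardFactors_le {n : ℕ} (hn : n ≠ 0) :
    Nat.minFac n ^ ArithmeticFunction.cardFactors n ≤ n := by
  rw [ArithmeticFunction.cardFactors_apply]
  conv_rhs => rw [← Nat.prod_primeFactorsList hn]
  exact List.pow_card_le_prod _ _ fun p hp =>
    Nat.minFac_le_of_dvd (Nat.prime_of_mem_primeFactorsList hp).two_le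
      (Nat.dvd_of_mem_primeFactorsList hp)

/-- The always-empty cells: `A_0(x) = 0` … -/
theorem cell_zero (u x : ℕ) : cell u x 0 = 0 := by
  unfold cell
  rw [Finset.card_eq_zero, Finset.filter_eq_empty_iff]
  rintro n hn ⟨hlt, hΩ⟩
  rw [Finset.mem_Icc] at hn
  rcases ArithmeticFunction.cardFactors_eq_zero_iff_eq_zero_or_one.mp hΩ with rfl | rfl
  · omega
  · rw [Nat.minFac_one, Nat.cast_one] at hlt
    exact absurd (one_le_threshold u hn.2) (not_le.mpr hlt)

/-- … and `A_j(x) = 0` for `j ≥ u ≥ 1`: `u` prime factors above `x^{1/u}` do not fit below `x`. -/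
theorem cell_eq_zero_of_le {u x j : ℕ} (hu : 1 ≤ u) (hj : u ≤ j) : cell u x j = 0 := by
  unfold cell
  rw [Finset.card_eq_zero, Finset.filter_eq_empty_iff]
  rintro n hn ⟨hlt, hΩ⟩
  rw [Finset.mem_Icc] at hn
  have hn0 : n ≠ 0 := by omega
  have hmf : (Nat.minFac n : ℝ) ^ u ≤ n := by
    have h1 : Nat.minFac n ^ j ≤ n := hΩ ▸ minFac_pow_cardFactors_le hn0
    have h2 : Nat.minFac n ^ u ≤ Nat.minFac n ^ j := Nat.pow_le_pow_right (Nat.minFac_pos n) hj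
    exact_mod_cast h2.trans h1
  have hx0 : (0 : ℝ) ≤ (x : ℝ) ^ ((1 : ℝ) / u) := by positivity
  have hlt' : ((x : ℝ) ^ ((1 : ℝ) / u)) ^ u < (Nat.minFac n : ℝ) ^ u :=
    pow_lt_pow_left₀ hlt hx0 (by omega)
  rw [one_div, Real.rpow_inv_natCast_pow (Nat.cast_nonneg _) (by omega)] at hlt'
  have : (n : ℝ) ≤ x := by exact_mod_cast hn.2
  linarith

/-- The REDUCED real cell polynomial `Q_{u,x} = Σ_{j<u} A_{j+1}(x) X^j ∈ ℝ[X]` (`P_{u,x}(z) = z·Q_{u,x}(z)`). -/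
noncomputable def cellPolyQ (u x : ℕ) : ℝ[X] :=
  ∑ j ∈ Finset.range u, C ((cell u x (j + 1) : ℕ) : ℝ) * X ^ j

theorem cellPolyQ_coeff (u x i : ℕ) :
    (cellPolyQ u x).coeff i = if i < u then ((cell u x (i + 1) : ℕ) : ℝ) else 0 := by
  unfold cellPolyQ
  rw [finsetSum_coeff]
  simp only [coeff_C_mul_X_pow]
  rw [Finset.sum_ite_eq]
  simp [Finset.mem_range]

theorem cellPolyQ_eval (u x : ℕ) (t : ℝ) :
    (cellPolyQ u x).eval t = ∑ j ∈ Finset.range u, ((cell u x (j + 1) : ℕ) : ℝ) * t ^ j := by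
  unfold cellPolyQ
  rw [eval_finsetSum]
  simp only [eval_mul, eval_C, eval_pow, eval_X]

theorem cellPolyQ_map_eval (u x : ℕ) (z : ℂ) :
    ((cellPolyQ u x).map (algebraMap ℝ ℂ)).eval z = ∑ j ∈ Finset.range u, ((cell u x (j + 1) : ℕ) : ℂ) * z ^ j := by
  unfold cellPolyQ
  rw [Polynomial.map_sum, eval_finsetSum]
  simp only [Polynomial.map_mul, Polynomial.map_C, Polynomial.map_pow, Polynomial.map_X, eval_mul, eval_C,
    eval_pow, eval_X, Complex.coe_algebraMap, Complex.ofReal_natCast]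

/-- `P_{u,x}(z) = z · Q_{u,x}(z)`. -/
theorem cellPoly_eq_mul_Q (u x : ℕ) (z : ℂ) :
    cellPoly u x z = z * ((cellPolyQ u x).map (algebraMap ℝ ℂ)).eval z := by
  rw [cellPolyQ_map_eval, cellPoly, Finset.sum_range_succ', cell_zero, Finset.mul_sum]
  simp only [Nat.cast_zero, zero_mul, add_zero, pow_zero]
  refine Finset.sum_congr rfl fun j _ => ?_
  ring

/-- The reduced polynomial has degree `≤ u − 2` (`A_u = 0`). -/
theorem natDegree_cellPolyQ_le (u x : ℕ) (hu : 1 ≤ u) : (cellPolyQ u x).natDegree ≤ u - 2 := by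
  rw [natDegree_le_iff_coeff_eq_zero]
  intro N hN
  rw [cellPolyQ_coeff]
  split_ifs with h
  · rw [cell_eq_zero_of_le hu (by omega)]
    simp
  · rfl

/-- TRANSFER, polynomial core: a real polynomial with as many real roots as its degree has only
real complex roots. -/
theorem im_eq_zero_of_natDegree_le_card_roots {p : ℝ[X]} (hp : p ≠ 0)
    (hcard : p.natDegree ≤ p.roots.card) {z : ℂ} (hz : (p.map (algebraMap ℝ ℂ)).eval z = 0) :
    z.im = 0 := by
  have hsplit : p.roots.card = p.natDegree := le_antisymm (card_roots' p) hcard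
  have hroots : p.roots.map (algebraMap ℝ ℂ) = (p.map (algebraMap ℝ ℂ)).roots :=
    roots_map_of_injective_of_card_eq_natDegree (algebraMap ℝ ℂ).injective hsplit
  have hmap0 : p.map (algebraMap ℝ ℂ) ≠ 0 := (Polynomial.map_ne_zero_iff (algebraMap ℝ ℂ).injective).mpr hp
  have hzmem : z ∈ (p.map (algebraMap ℝ ℂ)).roots := (mem_roots hmap0).mpr hz
  rw [← hroots, Multiset.mem_map] at hzmem
  obtain ⟨r, -, rfl⟩ := hzmem
  simp

/-- IVT COUNT: strict sign alternation at `d + 1` increasing points gives `d` real roots. -/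
theorem le_card_roots_of_alternating (p : ℝ[X]) {d : ℕ} (t : ℕ → ℝ)
    (ht : ∀ i < d, t i < t (i + 1)) (hsign : ∀ i < d, p.eval (t i) * p.eval (t (i + 1)) < 0)
    (hp : p ≠ 0) : d ≤ p.roots.card := by
  have hex : ∀ i < d, ∃ r, t i < r ∧ r < t (i + 1) ∧ p.IsRoot r := by
    intro i hi
    have hcont : ContinuousOn (fun s => p.eval s) (Set.Icc (t i) (t (i + 1))) :=
      p.continuous.continuousOn
    rcases mul_neg_iff.mp (hsign i hi) with ⟨ha, hb⟩ | ⟨ha, hb⟩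
    · obtain ⟨r, hr, hr0⟩ := intermediate_value_Ioo' (ht i hi).le hcont ⟨hb, ha⟩
      exact ⟨r, hr.1, hr.2, hr0⟩
    · obtain ⟨r, hr, hr0⟩ := intermediate_value_Ioo (ht i hi).le hcont ⟨ha, hb⟩
      exact ⟨r, hr.1, hr.2, hr0⟩
  choose! r hr using hex
  have htmono : ∀ n i, i + n ≤ d → t i ≤ t (i + n) := by
    intro n
    induction n with
    | zero => intro i _; simp
    | succ n ih =>
      intro i hi
      calc t i ≤ t (i + n) := ih i (by omega)
        _ ≤ t (i + n + 1) := (ht (i + n) (by omega)).le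
  have hrmono : ∀ i j, i < j → j < d → r i < r j := by
    intro i j hij hjd
    calc r i < t (i + 1) := (hr i (by omega)).2.1
      _ ≤ t (i + 1 + (j - (i + 1))) := htmono _ _ (by omega)
      _ = t j := by rw [show i + 1 + (j - (i + 1)) = j by omega]
      _ < r j := (hr j hjd).1
  have hinj : Set.InjOn r (Finset.range d : Set ℕ) := by
    intro i hi j hj hij
    simp only [Finset.coe_range, Set.mem_Iio] at hi hj
    by_contra hne
    rcases lt_or_gt_of_ne hne with h | h
    · exact absurd hij (hrmono i j h hj).ne
    · exact absurd hij.symm (hrmono j i h hi).ne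
  calc d = ((Finset.range d).image r).card := by rw [Finset.card_image_of_injOn hinj, Finset.card_range]
    _ ≤ p.roots.toFinset.card := by
        refine Finset.card_le_card fun s hs => ?_
        obtain ⟨i, hi, rfl⟩ := Finset.mem_image.mp hs
        rw [Multiset.mem_toFinset, mem_roots hp]
        exact (hr i (Finset.mem_range.mp hi)).2.2
    _ ≤ p.roots.card := Multiset.toFinset_card_le _

/-- TRANSFER (the prover route's last step): if the reduced real cell polynomial `Q_{u,x}` changes sign
strictly between `d + 1` increasing real points, where `d ≥ deg Q_{u,x}` (e.g. `d = u − 2`, see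
`natDegree_cellPolyQ_le`) and `d ≥ 1`, then `P_{u,x}` has only real zeros. -/
theorem realRootedAt_of_alternating {u x d : ℕ} (t : ℕ → ℝ) (ht : ∀ i < d, t i < t (i + 1))
    (hsign : ∀ i < d, (cellPolyQ u x).eval (t i) * (cellPolyQ u x).eval (t (i + 1)) < 0)
    (hdeg : (cellPolyQ u x).natDegree ≤ d) (hd : 0 < d) : RealRootedAt u x := by
  intro z hz
  have hp : cellPolyQ u x ≠ 0 := fun h => by
    have := hsign 0 hd
    simp [h] at this
  rw [cellPoly_eq_mul_Q] at hz
  rcases mul_eq_zero.mp hz with rfl | hz'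
  · simp
  · exact im_eq_zero_of_natDegree_le_card_roots hp
      (hdeg.trans (le_card_roots_of_alternating _ t ht hsign hp)) hz'

/-- Degenerate but useful: if `Q_{u,x}` has degree `≤ 1` and is nonzero, `P_{u,x}` is real-rooted. -/
theorem realRootedAt_of_natDegree_le_one {u x : ℕ} (hdeg : (cellPolyQ u x).natDegree ≤ 1)
    (hne : cellPolyQ u x ≠ 0) : RealRootedAt u x := by
  intro z hz
  rw [cellPoly_eq_mul_Q] at hz
  rcases mul_eq_zero.mp hz with rfl | hz'
  · simp
  · -- Q = a + b X with real a, b, not both zero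
    have hab : ∀ w : ℂ, ((cellPolyQ u x).map (algebraMap ℝ ℂ)).eval w =
        ((cellPolyQ u x).coeff 0 : ℂ) + ((cellPolyQ u x).coeff 1 : ℂ) * w := by
      intro w
      have hq := (cellPolyQ u x).as_sum_range' 2 (by omega)
      conv_lhs => rw [hq]
      simp [Finset.sum_range_succ]
    rw [hab] at hz'
    by_cases hb : (cellPolyQ u x).coeff 1 = 0
    · rw [hb] at hz'
      simp only [Complex.ofReal_zero, zero_mul, add_zero, Complex.ofReal_eq_zero] at hz'
      exfalso
      apply hne
      refine Polynomial.ext fun i => ?_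
      rcases Nat.lt_or_ge i 2 with hi | hi
      · interval_cases i
        · simpa using hz'
        · simpa using hb
      · rw [coeff_zero]
        exact coeff_eq_zero_of_natDegree_lt (by omega)
    · have : z = -((cellPolyQ u x).coeff 0 : ℂ) / ((cellPolyQ u x).coeff 1 : ℂ) := by
        field_simp [Complex.ofReal_ne_zero.mpr hb] 
        linear_combination hz'
      rw [this, ← Complex.ofReal_neg, ← Complex.ofReal_div, Complex.ofReal_im]

/-! ### (B1) the trivially true cases `u = 2, 3` (for all `x ≥ 2`), and
### (C1) non-monotonicity in `x` at `u = 4`: `x = 26` real-rooted, `x = 27` not -/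

/-- At `u = 2` or `u = 3`, `Q` has degree `≤ 1`; it is nonzero as soon as some prime lies in
`(x^{1/u}, x]` — Bertrand supplies one in `(x/2, x]` for `x ≥ 2`. -/
theorem cell_one_pos {u x : ℕ} (hu : 2 ≤ u) (hx : 2 ≤ x) : 0 < cell u x 1 := by
  unfold cell
  rw [Finset.card_pos]
  obtain ⟨p, hp, hxp, hpx⟩ := Nat.exists_prime_lt_and_le_two_mul (x / 2) (by omega)
  refine ⟨p, Finset.mem_filter.mpr ⟨Finset.mem_Icc.mpr ⟨hp.one_lt.le, by omega⟩, ?_,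
    ArithmeticFunction.cardFactors_apply_prime hp⟩⟩
  rw [hp.minFac_eq]
  -- x^{1/u} ≤ x^{1/2} = √x < p since p > x/2 ≥ √x/… : use p² > x
  have hp2 : x < p ^ u := by
    have h2p : x < 2 * p := by omega
    have h2 : x < p ^ 2 := by nlinarith [hp.two_le]
    exact lt_of_lt_of_le h2 (Nat.pow_le_pow_right hp.pos hu)
  have hu' : (0 : ℝ) < u := by exact_mod_cast (show 0 < u by omega)
  rw [one_div, Real.rpow_inv_lt_iff_of_pos (Nat.cast_nonneg _) (Nat.cast_nonneg _) hu', Real.rpow_natCast]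
  exact_mod_cast hp2

theorem realRootedAt_two (x : ℕ) (hx : 2 ≤ x) : RealRootedAt 2 x := by
  refine realRootedAt_of_natDegree_le_one ((natDegree_cellPolyQ_le 2 x (by norm_num)).trans (by norm_num)) ?_
  intro h
  have := congrArg (fun q => q.coeff 0) h
  simp only [cellPolyQ_coeff, coeff_zero] at this
  simp at this
  exact (cell_one_pos (le_refl 2) hx).ne' this

theorem realRootedAt_three (x : ℕ) (hx : 2 ≤ x) : RealRootedAt 3 x := by
  refine realRootedAt_of_natDegree_le_one ((natDegree_cellPolyQ_le 3 x (by norm_num)).trans (by norm_num)) ?_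
  intro h
  have := congrArg (fun q => q.coeff 0) h
  simp only [cellPolyQ_coeff, coeff_zero] at this
  simp at this
  exact (cell_one_pos (by norm_num) hx).ne' this

/-- Cells at `u = 4`, `x = 26, 27` (window `2^4 ≤ x < 3^4`, so "rough" = "odd > 1"):
`A_1 = 8` (odd primes ≤ 23), `A_2 = 4` (`9,15,21,25`), `A_3(26) = 0`, `A_3(27) = 1` (`27`). -/
theorem cells_four_26_27 :
    cell 4 26 1 = 8 ∧ cell 4 26 2 = 4 ∧ cell 4 26 3 = 0 ∧
    cell 4 27 1 = 8 ∧ cell 4 27 2 = 4 ∧ cell 4 27 3 = 1 := by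
  have h26 : ∀ j, cell 4 26 j = ((Finset.Icc 1 26).filter (fun n => 3 ≤ Nat.minFac n ∧
      ArithmeticFunction.cardFactors n = j)).card := cell_eq_of_window (B := 3) (by norm_num) (by norm_num) (by norm_num)
  have h27 : ∀ j, cell 4 27 j = ((Finset.Icc 1 27).filter (fun n => 3 ≤ Nat.minFac n ∧
      ArithmeticFunction.cardFactors n = j)).card := cell_eq_of_window (B := 3) (by norm_num) (by norm_num) (by norm_num)
  simp only [h26, h27]
  refine ⟨?_, ?_, ?_, ?_, ?_, ?_⟩ <;>
  · rw [Finset.card_filter]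
    simp [Finset.sum_Icc_succ_top, ArithmeticFunction.cardFactors_apply, Nat.primeFactorsList_ofNat]
    norm_num

/-- (C1a) `P_{4,26}(z) = 8z + 4z²` is real-rooted … -/
theorem realRootedAt_four_26 : RealRootedAt 4 26 := by
  obtain ⟨h1, h2, h3, -, -, -⟩ := cells_four_26_27
  refine realRootedAt_of_natDegree_le_one ?_ ?_
  · rw [natDegree_le_iff_coeff_eq_zero]
    intro N hN
    rw [cellPolyQ_coeff]
    split_ifs with h
    · interval_cases N
      · simp [h3]
      · simp [cell_eq_zero_of_le (u := 4) (x := 26) (j := 4) (by norm_num) (by norm_num)]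
    · rfl
  · intro h
    have := congrArg (fun q => q.coeff 0) h
    simp only [cellPolyQ_coeff, coeff_zero] at this
    simp [h1] at this

/-- (C1b) … but `P_{4,27}(z) = 8z + 4z² + z³ = z((z+2)² + 4)` is not: real-rootedness is NOT
monotone in `x` (so "for all large x" cannot be weakened to "for some x₁ and then inherited"). -/
theorem not_realRootedAt_four_27 : ¬ RealRootedAt 4 27 := by
  obtain ⟨-, -, -, h1, h2, h3⟩ := cells_four_26_27
  intro h
  obtain ⟨z, hz⟩ : ∃ z : ℂ, z ^ 2 + 4 * z + 8 = 0 := by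
    obtain ⟨z, hz⟩ := IsAlgClosed.exists_root (C 1 * X ^ 2 + C 4 * X + C 8 : ℂ[X])
      (by rw [Polynomial.degree_quadratic (by norm_num)]; norm_num)
    exact ⟨z, by simpa [IsRoot] using hz⟩
  have hP : cellPoly 4 27 z = 8 * z + 4 * z ^ 2 + z ^ 3 := by
    simp [cellPoly, Finset.sum_range_succ, cell_zero, h1, h2, h3,
      cell_eq_zero_of_le (u := 4) (x := 27) (j := 4) (by norm_num) (by norm_num)]
  have him : z.im = 0 := h z (by rw [hP]; linear_combination z * hz)
  have hre : (z.re : ℂ) = z := Complex.ext rfl (by simp [him])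
  rw [← hre] at hz
  norm_cast at hz
  nlinarith [sq_nonneg (z.re + 2)]

/-- Real-rootedness of `P_{u,x}` is not monotone in `x`. -/
theorem not_monotone_in_x : ¬ (∀ u x y : ℕ, 2 ≤ u → x ≤ y → RealRootedAt u x → RealRootedAt u y) :=
  fun h => not_realRootedAt_four_27 (h 4 26 27 (by norm_num) (by norm_num) realRootedAt_four_26)


/-! ## §G A reusable NEGATIVE criterion: the top-three-cell obstruction (first Newton inequality)

If `A_D > 0` is the top non-vanishing cell (`D ≥ 3`), the reduced polynomial `Q_{u,x}` has degree `D−1`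
and, were all its zeros real, `e₁ = −A_{D−1}/A_D`, `e₂ = A_{D−2}/A_D` would satisfy Cauchy–Schwarz
`(Σ rᵢ)² ≤ (D−1) Σ rᵢ²`, i.e. `(D−2)·A_{D−1}² ≥ 2(D−1)·A_D·A_{D−2}` (for `D = 3`: the discriminant
`A₂² ≥ 4A₁A₃`). So `(D−2)A_{D−1}² < 2(D−1)A_D A_{D−2}` ⇒ `¬ RealRootedAt u x`. This is the mechanism
behind A1 (`x = 8`: `4,2,1`), B2 (`x = 480`: `90,59,10`), E1 (`1,2,7`) and the numerically observed
failures at `x = B^u − 1` (stabilised cells in the docblock: there even `A_{D−1}² < 2A_D A_{D−2}`);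
any future exact computation of three top cells plugs in here. -/

theorem im_multiset_sum (s : Multiset ℂ) : s.sum.im = (s.map Complex.im).sum := by
  induction s using Multiset.induction_on with
  | empty => simp
  | cons a s ih => simp [ih]

/-- Cauchy–Schwarz with ones: `(Σ r)² ≤ #s · Σ r²` for a multiset of reals. -/
theorem sq_sum_le_card_mul_sum_sq (s : Multiset ℝ) :
    s.sum ^ 2 ≤ (s.card : ℝ) * (s.map (fun r => r ^ 2)).sum := by
  induction s using Multiset.induction_on with
  | empty => simp
  | cons a s ih =>
    simp only [Multiset.sum_cons, Multiset.card_cons, Multiset.map_cons, Nat.cast_add, Nat.cast_one]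
    rcases Nat.eq_zero_or_pos s.card with h0 | hpos
    · have hs : s = 0 := Multiset.card_eq_zero.mp h0
      subst hs
      simp
    · have hn : (0 : ℝ) < (s.card : ℝ) := by exact_mod_cast hpos
      have key : (s.card : ℝ) * (((s.card : ℝ) + 1) * (a ^ 2 + (s.map (fun r => r ^ 2)).sum) - (a + s.sum) ^ 2)
          = ((s.card : ℝ) * a - s.sum) ^ 2
            + ((s.card : ℝ) + 1) * ((s.card : ℝ) * (s.map (fun r => r ^ 2)).sum - s.sum ^ 2) := by
        ring
      have hrhs : 0 ≤ ((s.card : ℝ) * a - s.sum) ^ 2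
            + ((s.card : ℝ) + 1) * ((s.card : ℝ) * (s.map (fun r => r ^ 2)).sum - s.sum ^ 2) := by
        nlinarith
      have hslack : 0 ≤ ((s.card : ℝ) + 1) * (a ^ 2 + (s.map (fun r => r ^ 2)).sum) - (a + s.sum) ^ 2 := by
        by_contra hneg
        have hneg' : ((s.card : ℝ) + 1) * (a ^ 2 + (s.map (fun r => r ^ 2)).sum) - (a + s.sum) ^ 2 < 0 :=
          lt_of_not_ge hneg
        have := mul_neg_of_pos_of_neg hn hneg'
        linarith
      linarith

/-- `Q_{u,x}` pushed to `ℂ[X]`. -/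
theorem cellPolyQ_map_coeff (u x i : ℕ) :
    ((cellPolyQ u x).map (algebraMap ℝ ℂ)).coeff i = if i < u then ((cell u x (i + 1) : ℕ) : ℂ) else 0 := by
  rw [coeff_map, cellPolyQ_coeff]
  split_ifs <;> simp

/-- TOP-THREE-CELL OBSTRUCTION (sharp first Newton inequality for the reduced polynomial):
`A_j = 0 (j > D)`, `A_D > 0`, `D ≥ 3`, `(D−2)·A_{D−1}² < 2(D−1)·A_D·A_{D−2}` ⇒ not real-rooted. -/
theorem not_realRootedAt_of_top_cells {u x D : ℕ} (hD : 3 ≤ D) (htop : ∀ j, D < j → cell u x j = 0)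
    (hpos : 0 < cell u x D)
    (hnewton : (D - 2) * cell u x (D - 1) ^ 2 < 2 * (D - 1) * cell u x D * cell u x (D - 2)) :
    ¬ RealRootedAt u x := by
  intro hreal
  have hu : 1 ≤ u := by
    rcases Nat.eq_zero_or_pos u with rfl | h
    · exact absurd hreal (not_realRootedAt_zero x)
    · exact h
  have hDu : D < u := by
    by_contra h
    have := cell_eq_zero_of_le (x := x) (j := D) hu (by omega)
    omega
  set P := (cellPolyQ u x).map (algebraMap ℝ ℂ) with hP
  have hcoeff : ∀ i, P.coeff i = if i < u then ((cell u x (i + 1) : ℕ) : ℂ) else 0 :=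
    cellPolyQ_map_coeff u x
  have hdeg : P.natDegree = D - 1 := by
    apply natDegree_eq_of_le_of_coeff_ne_zero
    · rw [natDegree_le_iff_coeff_eq_zero]
      intro N hN
      rw [hcoeff]
      split_ifs
      · rw [htop (N + 1) (by omega)]; simp
      · rfl
    · rw [hcoeff, if_pos (by omega), show D - 1 + 1 = D by omega]
      exact_mod_cast hpos.ne'
  have hlead : P.leadingCoeff = (cell u x D : ℂ) := by
    rw [leadingCoeff, hdeg, hcoeff, if_pos (by omega), show D - 1 + 1 = D by omega]
  have hlead0 : P.leadingCoeff ≠ 0 := by rw [hlead]; exact_mod_cast hpos.ne'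
  have hP0 : P ≠ 0 := leadingCoeff_ne_zero.mp hlead0
  have hroots : P.roots.card = P.natDegree := IsAlgClosed.card_roots_eq_natDegree
  have hv1 := coeff_eq_esymm_roots_of_card hroots (show D - 2 ≤ P.natDegree by omega)
  have hv2 := coeff_eq_esymm_roots_of_card hroots (show D - 3 ≤ P.natDegree by omega)
  rw [hdeg, hlead, hcoeff, if_pos (by omega), show D - 1 - (D - 2) = 1 by omega,
    show D - 2 + 1 = D - 1 by omega, esymm_one_eq_sum] at hv1
  rw [hdeg, hlead, hcoeff, if_pos (by omega), show D - 1 - (D - 3) = 2 by omega,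
    show D - 3 + 1 = D - 2 by omega] at hv2
  -- all roots of P are real: a root z of Q gives the root z of P_{u,x} = z·Q(z)
  have him : ∀ r ∈ P.roots, r.im = 0 := fun r hr =>
    hreal r (by rw [cellPoly_eq_mul_Q, (mem_roots hP0).mp hr, mul_zero])
  have hN := sum_map_sq_eq P.roots
  -- the roots are the real numbers R := roots.map re
  set R : Multiset ℝ := P.roots.map Complex.re with hR
  have hsumR : P.roots.sum = ((R.sum : ℝ) : ℂ) := by
    apply Complex.ext
    · rw [re_multiset_sum, Complex.ofReal_re]
    · rw [im_multiset_sum, Complex.ofReal_im, Multiset.sum_eq_zero]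
      intro y hy
      obtain ⟨r, hr, rfl⟩ := Multiset.mem_map.mp hy
      exact him r hr
  have hS : (P.roots.map (fun r => r ^ 2)).sum = (((R.map (fun r => r ^ 2)).sum : ℝ) : ℂ) := by
    apply Complex.ext
    · rw [re_multiset_sum, Multiset.map_map, Complex.ofReal_re, hR, Multiset.map_map]
      congr 1
      refine Multiset.map_congr rfl fun r hr => ?_
      simp only [Function.comp_apply, sq, Complex.mul_re, him r hr]
      ring
    · rw [im_multiset_sum, Multiset.map_map, Complex.ofReal_im, Multiset.sum_eq_zero]
      intro y hy
      obtain ⟨r, hr, rfl⟩ := Multiset.mem_map.mp hy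
      simp [sq, Complex.mul_im, him r hr]
  have hcardR : (R.card : ℝ) = (D - 1 : ℕ) := by
    rw [hR, Multiset.card_map, hroots, hdeg]
  have hCS := sq_sum_le_card_mul_sum_sq R
  rw [hcardR] at hCS
  -- Vieta in terms of real quantities
  have hs : (cell u x D : ℂ) * P.roots.sum = -(cell u x (D - 1) : ℂ) := by
    simp only [pow_one] at hv1
    linear_combination hv1
  have he2 : (cell u x D : ℂ) * P.roots.esymm 2 = (cell u x (D - 2) : ℂ) := by
    norm_num at hv2
    linear_combination -hv2
  -- A_D² Σr² = A_{D-1}² − 2 A_D A_{D−2}  and  A_D Σ r = −A_{D−1}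
  have key : ((cell u x D : ℕ) : ℂ) ^ 2 * (P.roots.map (fun r => r ^ 2)).sum =
      ((cell u x (D - 1) : ℕ) : ℂ) ^ 2 - 2 * ((cell u x D : ℕ) : ℂ) * ((cell u x (D - 2) : ℕ) : ℂ) := by
    rw [hN]
    linear_combination ((cell u x D : ℂ) * P.roots.sum - (cell u x (D - 1) : ℂ)) * hs
      - 2 * (cell u x D : ℂ) * he2
  rw [hS] at key
  rw [hsumR] at hs
  -- move the two identities to ℝ
  have hsR : (cell u x D : ℝ) * R.sum = -(cell u x (D - 1) : ℝ) := by
    apply Complex.ofReal_injective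
    push_cast
    exact hs
  have keyR : (cell u x D : ℝ) ^ 2 * (R.map (fun r => r ^ 2)).sum =
      (cell u x (D - 1) : ℝ) ^ 2 - 2 * (cell u x D : ℝ) * (cell u x (D - 2) : ℝ) := by
    apply Complex.ofReal_injective
    push_cast
    exact key
  have ha : (0 : ℝ) < (cell u x D : ℝ) := by exact_mod_cast hpos
  have hlt : ((D - 2 : ℕ) : ℝ) * (cell u x (D - 1) : ℝ) ^ 2 <
      2 * ((D - 1 : ℕ) : ℝ) * (cell u x D : ℝ) * (cell u x (D - 2) : ℝ) := by
    exact_mod_cast hnewton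
  have hD1 : ((D - 1 : ℕ) : ℝ) = ((D - 2 : ℕ) : ℝ) + 1 := by
    rw [show D - 1 = (D - 2) + 1 by omega]; push_cast; ring
  have hd0 : (0 : ℝ) ≤ ((D - 2 : ℕ) : ℝ) := by positivity
  -- (Σ r)² ≤ (D-1) Σ r², times A_D²:  A_{D-1}² ≤ (D-1)(A_{D-1}² - 2 A_D A_{D-2})
  have h1 : (cell u x D : ℝ) ^ 2 * R.sum ^ 2 ≤
      (cell u x D : ℝ) ^ 2 * (((D - 1 : ℕ) : ℝ) * (R.map (fun r => r ^ 2)).sum) :=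
    mul_le_mul_of_nonneg_left hCS (by positivity)
  have h2 : (cell u x D : ℝ) ^ 2 * R.sum ^ 2 = (cell u x (D - 1) : ℝ) ^ 2 := by
    have : ((cell u x D : ℝ) * R.sum) ^ 2 = (-(cell u x (D - 1) : ℝ)) ^ 2 := by rw [hsR]
    nlinarith
  rw [hD1] at hlt h1
  nlinarith

/-- A1 again, as an instance of the criterion: `(A₁,A₂,A₃)(8) = (4,2,1)`, `1·2² < 4·1·4`. -/
theorem not_realRootedAt_eight' (u : ℕ) (hu : 4 ≤ u) : ¬ RealRootedAt u 8 := by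
  have hx : (8 : ℕ) < 2 ^ u := lt_of_lt_of_le (by norm_num) (Nat.pow_le_pow_right (by norm_num) hu)
  have hcell : ∀ j, cell u 8 j = (lset 8 j).card := cell_eq_card_lset (by norm_num) hx (by omega)
  obtain ⟨h1, h2, h3⟩ := card_lset_eight
  refine not_realRootedAt_of_top_cells (D := 3) le_rfl ?_ ?_ ?_
  · intro j hj
    have : (8 : ℕ) < 2 ^ j := lt_of_lt_of_le (by norm_num) (Nat.pow_le_pow_right (by norm_num) hj)
    exact cell_eq_zero_of_lt this
  · rw [hcell, h3]; norm_num
  · rw [hcell, hcell, hcell]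
    simp only [show 3 - 1 = 2 from rfl, show 3 - 2 = 1 from rfl, h1, h2, h3]
    norm_num

/-- E1's endgame via the criterion: top cells `7, 2, 1` at indices `D−2, D−1, D` (`D ≥ 5`). -/
theorem not_realRootedAt_of_cells_721 {u x D : ℕ} (hD : 5 ≤ D) (htop : ∀ j, D < j → cell u x j = 0)
    (h0 : cell u x D = 1) (h1 : cell u x (D - 1) = 2) (h2 : cell u x (D - 2) = 7) : ¬ RealRootedAt u x :=
  not_realRootedAt_of_top_cells (by omega) htop (by omega) (by
    rw [h0, h1, h2]
    have : (D - 2) * 2 ^ 2 < 2 * (D - 1) * 1 * 7 := by omega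
    exact this)


/-! ## §H THRESHOLD GROWTH (gen-3 seat, cycle 2): `x₀(u)^{1/u} → ∞` — gen-2's conjecture PROVED

For every `B` and all large `u`, every admissible threshold satisfies `x₀(u) ≥ B^u`
(`threshold_ge_pow`); at prime `B`, `P_{u,B^u−1}` is not real-rooted for all large `u`
(`not_realRootedAt_prime_pow_sub_one`); the strengthening "`x ≥ B^u` suffices"
(`ModelHyperbolicityExpThreshold`, suggested by `x₀(5,6,7) = 7^u`) is false. Mechanism: the MACLAURIN
OBSTRUCTION `not_realRootedAt_of_maclaurin` (`m!·A_{D−m}·A_D^{m−1} ≤ A_{D−1}^m` for real-rooted cells —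
all higher Newton windows at once, part 4 = §G being `m = 2`) against the UNIFORM bound
`A_{u−2}(B^u−1) ≤ B^{B³+1}` (`cell_prime_pow_sub_one_le`) and `A_{u−1}, A_{u−1−m} ≥ 1`; no prime number
theory. LANDING as `Theorems/ModelHyperbolicity/Negative/ModelHyperbolicityMaclaurin.lean` (part 6) and
`…ThresholdGrowth.lean` (part 7). -/

/-! ## §H1 Maclaurin's inequality `m!·e_m(a) ≤ (Σ a)^m` for non-negative reals -/

theorem esymm_zero_eq_one {R : Type*} [CommSemiring R] (s : Multiset R) : s.esymm 0 = 1 := by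
  simp [Multiset.esymm, Multiset.powersetCard_zero_left]

theorem esymm_succ_cons {R : Type*} [CommSemiring R] (a : R) (s : Multiset R) (i : ℕ) :
    (a ::ₘ s).esymm (i + 1) = s.esymm (i + 1) + a * s.esymm i := by
  simp only [Multiset.esymm]
  rw [Multiset.powersetCard_cons, Multiset.map_add, Multiset.sum_add, Multiset.map_map]
  congr 1
  simp only [Function.comp_def, Multiset.prod_cons]
  rw [Multiset.sum_map_mul_left]

theorem esymm_nonneg {s : Multiset ℝ} (hs : ∀ x ∈ s, 0 ≤ x) (i : ℕ) : 0 ≤ s.esymm i := by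
  simp only [Multiset.esymm]
  refine Multiset.sum_nonneg fun y hy => ?_
  obtain ⟨t, ht, rfl⟩ := Multiset.mem_map.mp hy
  exact Multiset.prod_nonneg fun b hb =>
    hs b (Multiset.mem_of_le (Multiset.mem_powersetCard.mp ht).1 hb)

/-- Bernoulli with two terms: `S^{n+1} + (n+1)·a·S^n ≤ (S + a)^{n+1}` for `S, a ≥ 0`. -/
theorem pow_succ_add_mul_le {S a : ℝ} (hS : 0 ≤ S) (ha : 0 ≤ a) (n : ℕ) :
    S ^ (n + 1) + (n + 1 : ℝ) * a * S ^ n ≤ (S + a) ^ (n + 1) := by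
  induction n with
  | zero => simp
  | succ n ih =>
    set T := S ^ n with hT
    set P := (S + a) ^ (n + 1) with hP
    have hT0 : 0 ≤ T := pow_nonneg hS n
    have H := mul_le_mul_of_nonneg_left ih (add_nonneg hS ha)
    have hn : (0 : ℝ) ≤ n := Nat.cast_nonneg n
    have e1 : (S + a) ^ (n + 1 + 1) = (S + a) * P := by rw [hP]; ring
    have e2 : S ^ (n + 1 + 1) = S * S * T := by rw [hT]; ring
    have e3 : S ^ (n + 1) = S * T := by rw [hT]; ring
    rw [e1, e2, e3]
    rw [e3] at H
    push_cast
    nlinarith [H, mul_nonneg (mul_nonneg (mul_nonneg ha ha) hT0) hn, mul_nonneg (mul_nonneg ha ha) hT0]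

/-- MACLAURIN: for a multiset `a` of non-negative reals, `m! · e_m(a) ≤ (Σ a)^m`. -/
theorem factorial_mul_esymm_le_sum_pow (s : Multiset ℝ) (hs : ∀ x ∈ s, 0 ≤ x) (m : ℕ) :
    (m ! : ℝ) * s.esymm m ≤ s.sum ^ m := by
  induction s using Multiset.induction_on generalizing m with
  | empty =>
    cases m with
    | zero => simp [esymm_zero_eq_one]
    | succ m => simp [Multiset.esymm]
  | cons a s ih =>
    have ha : 0 ≤ a := hs a (Multiset.mem_cons_self a s)
    have hs' : ∀ x ∈ s, 0 ≤ x := fun x hx => hs x (Multiset.mem_cons_of_mem hx)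
    have hS : 0 ≤ s.sum := Multiset.sum_nonneg hs'
    cases m with
    | zero => simp [esymm_zero_eq_one]
    | succ m =>
      rw [esymm_succ_cons, Multiset.sum_cons, Nat.factorial_succ]
      have ih1 := ih hs' (m + 1)
      have ih0 := ih hs' m
      have hem : 0 ≤ s.esymm m := esymm_nonneg hs' m
      push_cast
      calc ((m : ℝ) + 1) * m ! * (s.esymm (m + 1) + a * s.esymm m)
          = ((m : ℝ) + 1) * ((((m + 1)! : ℕ) : ℝ) * s.esymm (m + 1)) / ((m : ℝ) + 1)
              + ((m : ℝ) + 1) * a * ((m ! : ℝ) * s.esymm m) := by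
            rw [Nat.factorial_succ]; push_cast; field_simp
        _ ≤ ((m : ℝ) + 1) * s.sum ^ (m + 1) / ((m : ℝ) + 1) + ((m : ℝ) + 1) * a * s.sum ^ m := by
            gcongr
        _ = s.sum ^ (m + 1) + ((m : ℝ) + 1) * a * s.sum ^ m := by field_simp
        _ ≤ (s.sum + a) ^ (m + 1) := pow_succ_add_mul_le hS ha m
        _ = (a + s.sum) ^ (m + 1) := by ring

/-! ## §H2 Real polynomials with only real complex zeros split over `ℝ`; the Maclaurin obstruction -/

/-- A nonzero real polynomial all of whose complex zeros are real has `natDegree` real roots. -/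
theorem card_roots_eq_natDegree_of_im_eq_zero {p : ℝ[X]} (hp : p ≠ 0)
    (h : ∀ z : ℂ, (p.map (algebraMap ℝ ℂ)).eval z = 0 → z.im = 0) : p.roots.card = p.natDegree := by
  set q := p.map (algebraMap ℝ ℂ) with hq
  have hinj : Function.Injective (algebraMap ℝ ℂ) := (algebraMap ℝ ℂ).injective
  have hq0 : q ≠ 0 := (Polynomial.map_ne_zero_iff hinj).mpr hp
  have hqcard : q.roots.card = p.natDegree := by
    rw [IsAlgClosed.card_roots_eq_natDegree, natDegree_map_eq_of_injective hinj]
  -- q.roots ≤ p.roots.map ofReal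
  have hle : q.roots ≤ p.roots.map (algebraMap ℝ ℂ) := by
    rw [Multiset.le_iff_count]
    intro b
    by_cases hb : b ∈ q.roots
    · have hb0 : b.im = 0 := h b ((mem_roots hq0).mp hb)
      have hbre : (algebraMap ℝ ℂ) b.re = b := Complex.ext rfl (by simp [hb0])
      rw [← hbre, Multiset.count_map_eq_count' _ _ hinj, count_roots, count_roots,
        ← eq_rootMultiplicity_map hinj]
    · rw [Multiset.count_eq_zero_of_notMem hb]
      exact Nat.zero_le _
  have h1 : p.natDegree ≤ p.roots.card := by
    calc p.natDegree = q.roots.card := hqcard.symm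
      _ ≤ (p.roots.map (algebraMap ℝ ℂ)).card := Multiset.card_le_card hle
      _ = p.roots.card := Multiset.card_map _ _
  exact le_antisymm (card_roots' p) h1

/-- `e_m(−s) = (−1)^m e_m(s)`. -/
theorem esymm_map_neg {R : Type*} [CommRing R] (s : Multiset R) (m : ℕ) :
    (s.map Neg.neg).esymm m = (-1) ^ m * s.esymm m := by
  simp only [Multiset.esymm]
  rw [Multiset.powersetCard_map, Multiset.map_map, ← Multiset.sum_map_mul_left]
  refine congrArg _ (Multiset.map_congr rfl fun t ht => ?_)
  simp only [Function.comp_apply]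
  rw [Multiset.prod_map_neg, (Multiset.mem_powersetCard.mp ht).2]

/-- MACLAURIN OBSTRUCTION. If `A_D > 0` is the top non-vanishing cell and, for some `2 ≤ m ≤ D − 1`,
`A_{D−1}^m < m! · A_{D−m} · A_D^{m−1}`, then `P_{u,x}` is not real-rooted. (Real zeros of the reduced
polynomial are `≤ 0` since its coefficients are `≥ 0`; by Vieta `A_{D−k} = A_D·e_k(a)` with `a ≥ 0` the
negated zeros; and `m!·e_m(a) ≤ e_1(a)^m`.) For `m = 2` compare part 4's sharper first Newton inequality. -/
theorem not_realRootedAt_of_maclaurin {u x D m : ℕ} (hm : 2 ≤ m) (hmD : m + 1 ≤ D)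
    (htop : ∀ j, D < j → cell u x j = 0) (hpos : 0 < cell u x D)
    (hlt : cell u x (D - 1) ^ m < m ! * cell u x (D - m) * cell u x D ^ (m - 1)) :
    ¬ RealRootedAt u x := by
  intro hreal
  have hu : 1 ≤ u := by
    rcases Nat.eq_zero_or_pos u with rfl | h
    · exact absurd hreal (not_realRootedAt_zero x)
    · exact h
  have hDu : D < u := by
    by_contra h
    have := cell_eq_zero_of_le (x := x) (j := D) hu (by omega)
    omega
  set Q := cellPolyQ u x with hQ
  have hcoeff : ∀ i, Q.coeff i = if i < u then ((cell u x (i + 1) : ℕ) : ℝ) else 0 := cellPolyQ_coeff u x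
  have hdeg : Q.natDegree = D - 1 := by
    apply natDegree_eq_of_le_of_coeff_ne_zero
    · rw [natDegree_le_iff_coeff_eq_zero]
      intro N hN
      rw [hcoeff]
      split_ifs
      · rw [htop (N + 1) (by omega)]; simp
      · rfl
    · rw [hcoeff, if_pos (by omega), show D - 1 + 1 = D by omega]
      exact_mod_cast hpos.ne'
  have hlead : Q.leadingCoeff = (cell u x D : ℝ) := by
    rw [leadingCoeff, hdeg, hcoeff, if_pos (by omega), show D - 1 + 1 = D by omega]
  have hQ0 : Q ≠ 0 := by
    intro h0; rw [h0, natDegree_zero] at hdeg; omega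
  -- all complex zeros of Q are real: a zero z of Q gives the zero z of P_{u,x} = z·Q(z)
  have him : ∀ z : ℂ, (Q.map (algebraMap ℝ ℂ)).eval z = 0 → z.im = 0 := fun z hz =>
    hreal z (by rw [cellPoly_eq_mul_Q, ← hQ, hz, mul_zero])
  have hcard : Q.roots.card = Q.natDegree := card_roots_eq_natDegree_of_im_eq_zero hQ0 him
  -- every (real) root is ≤ 0: at t > 0 the value is ≥ A_D t^{D-1} > 0
  have hroot_nonpos : ∀ r ∈ Q.roots, r ≤ 0 := by
    intro r hr
    have hr0 : Q.eval r = 0 := (mem_roots hQ0).mp hr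
    by_contra hpos'
    push Not at hpos'
    have hterm : ∀ i ∈ Finset.range u, (0 : ℝ) ≤ ((cell u x (i + 1) : ℕ) : ℝ) * r ^ i :=
      fun i _ => by positivity
    have hle := Finset.single_le_sum hterm (a := D - 1) (Finset.mem_range.mpr (by omega))
    rw [← cellPolyQ_eval, ← hQ, hr0, show D - 1 + 1 = D by omega] at hle
    have : (0 : ℝ) < ((cell u x D : ℕ) : ℝ) * r ^ (D - 1) := by
      have : (0 : ℝ) < (cell u x D : ℝ) := by exact_mod_cast hpos
      positivity
    linarith
  -- the negated roots
  set a : Multiset ℝ := Q.roots.map Neg.neg with ha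
  have ha_nonneg : ∀ y ∈ a, 0 ≤ y := by
    intro y hy
    obtain ⟨r, hr, rfl⟩ := Multiset.mem_map.mp hy
    have := hroot_nonpos r hr
    linarith
  -- Vieta: A_{D-k} = A_D * e_k(a) for k ≤ D - 1
  have hvieta : ∀ k, k ≤ D - 1 → ((cell u x (D - k) : ℕ) : ℝ) = (cell u x D : ℝ) * a.esymm k := by
    intro k hk
    have hv := coeff_eq_esymm_roots_of_card hcard (show D - 1 - k ≤ Q.natDegree by omega)
    rw [hdeg, hlead, hcoeff, if_pos (by omega), show D - 1 - (D - 1 - k) = k by omega,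
      show D - 1 - k + 1 = D - k by omega] at hv
    rw [hv, ha, esymm_map_neg]
    ring
  have hv1 := hvieta 1 (by omega)
  have hvm := hvieta m (by omega)
  rw [esymm_one_eq_sum] at hv1
  -- Maclaurin
  have hmac := factorial_mul_esymm_le_sum_pow a ha_nonneg m
  have hAD : (0 : ℝ) < (cell u x D : ℝ) := by exact_mod_cast hpos
  -- m! * A_{D-m} * A_D^(m-1) = A_D^m * (m! * e_m(a)) ≤ A_D^m * (a.sum)^m = A_{D-1}^m
  have key : (m ! : ℝ) * (cell u x (D - m) : ℝ) * (cell u x D : ℝ) ^ (m - 1) ≤ (cell u x (D - 1) : ℝ) ^ m := by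
    obtain ⟨m', rfl⟩ : ∃ m', m = m' + 1 := ⟨m - 1, by omega⟩
    rw [Nat.add_sub_cancel, hvm, hv1, mul_pow]
    calc ((m' + 1)! : ℝ) * ((cell u x D : ℝ) * a.esymm (m' + 1)) * (cell u x D : ℝ) ^ m'
        = (cell u x D : ℝ) ^ (m' + 1) * (((m' + 1)! : ℝ) * a.esymm (m' + 1)) := by ring
      _ ≤ (cell u x D : ℝ) ^ (m' + 1) * a.sum ^ (m' + 1) := by gcongr
  have hlt' : ((cell u x (D - 1) : ℕ) : ℝ) ^ m <
      (m ! : ℝ) * ((cell u x (D - m) : ℕ) : ℝ) * ((cell u x D : ℕ) : ℝ) ^ (m - 1) := by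
    exact_mod_cast hlt
  linarith

/-! ## §H3 The cells at `x = B^u − 1`, `B` prime -/

/-- At `x = B^u − 1` the roughness condition `x^{1/u} < P⁻(n)` reads `B ≤ P⁻(n)`. -/
theorem cell_prime_pow_sub_one (B u : ℕ) (hB : 2 ≤ B) (hu : 0 < u) (j : ℕ) :
    cell u (B ^ u - 1) j =
      ((Finset.Icc 1 (B ^ u - 1)).filter (fun n => B ≤ Nat.minFac n ∧ ArithmeticFunction.cardFactors n = j)).card := by
  have hBu : 0 < B ^ u := by positivity
  refine cell_eq_of_window (B := B) ?_ (Nat.sub_one_lt hBu.ne') hu j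
  exact Nat.le_sub_one_of_lt (Nat.pow_lt_pow_left (by omega) hu.ne')

/-- `B^k` (with `1 ≤ k < u`) lies in the cell `A_k(B^u − 1)`: the top cells are non-empty. -/
theorem one_le_cell_prime_pow_sub_one {B u k : ℕ} (hB : B.Prime) (hk : 1 ≤ k) (hku : k < u) :
    1 ≤ cell u (B ^ u - 1) k := by
  rw [cell_prime_pow_sub_one B u hB.two_le (by omega), Nat.one_le_iff_ne_zero, ← Nat.pos_iff_ne_zero,
    Finset.card_pos]
  refine ⟨B ^ k, Finset.mem_filter.mpr ⟨Finset.mem_Icc.mpr ⟨Nat.one_le_pow _ _ hB.pos, ?_⟩, ?_, ?_⟩⟩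
  · exact Nat.le_sub_one_of_lt (Nat.pow_lt_pow_right hB.one_lt hku)
  · rw [Nat.pow_minFac (by omega), hB.minFac_eq]
  · exact ArithmeticFunction.cardFactors_apply_prime_pow hB

/-- `(B + k)·B^k ≤ B·(B+1)^k`. -/
theorem add_mul_pow_le (B k : ℕ) : (B + k) * B ^ k ≤ B * (B + 1) ^ k := by
  induction k with
  | zero => simp
  | succ k ih =>
    have hpow : B ^ k ≤ (B + 1) ^ k := Nat.pow_le_pow_left (Nat.le_succ B) k
    calc (B + (k + 1)) * B ^ (k + 1) = ((B + k) * B ^ k) * B + B ^ k * B := by ring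
      _ ≤ (B * (B + 1) ^ k) * B + (B + 1) ^ k * B := by gcongr
      _ = B * (B + 1) ^ (k + 1) := by ring

/-- Bernoulli consequence: `B^{k+2} < (B+1)^k` once `k ≥ B³` (and `B ≥ 1`). -/
theorem pow_add_two_lt_succ_pow {B k : ℕ} (hB : 1 ≤ B) (hk : B ^ 3 ≤ k) : B ^ (k + 2) < (B + 1) ^ k := by
  have h := add_mul_pow_le B k
  have h1 : B * B ^ (k + 2) < B * (B + 1) ^ k := by
    calc B * B ^ (k + 2) = B ^ 3 * B ^ k := by ring
      _ ≤ k * B ^ k := Nat.mul_le_mul_right _ hk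
      _ < (B + k) * B ^ k := by
          apply Nat.mul_lt_mul_of_lt_of_le (by omega) le_rfl (by positivity)
      _ ≤ B * (B + 1) ^ k := h
  exact Nat.lt_of_mul_lt_mul_left h1

/-- If every prime factor of `m ≠ 0` is `≥ N` then `N^{Ω(m)} ≤ m`. -/
theorem pow_cardFactors_le_of_le_primeFactors {m N : ℕ} (hm : m ≠ 0)
    (h : ∀ q ∈ m.primeFactorsList, N ≤ q) : N ^ ArithmeticFunction.cardFactors m ≤ m := by
  rw [ArithmeticFunction.cardFactors_apply]
  conv_rhs => rw [← Nat.prod_primeFactorsList hm]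
  exact List.pow_card_le_prod _ _ h

/-- UNIFORM BOUND for the second cell from the top at `x = B^u − 1` (`B` prime):
`A_{u−2}(B^u − 1) ≤ B^{B³+1}` for every `u ≥ 2`. Strip the `B`-part of `n`: the cofactor
`m = n / B^{v_B(n)}` has all prime factors `≥ B + 1`, satisfies `(B+1)^{Ω(m)} ≤ m < B^{Ω(m)+2}`, hence
`Ω(m) < B³` and `m < B^{B³+1}`; and `n ↦ m` is injective on the cell (`v_B(n) = u − 2 − Ω(m)`). -/
theorem cell_prime_pow_sub_one_le {B u : ℕ} (hB : B.Prime) (hu : 2 ≤ u) :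
    cell u (B ^ u - 1) (u - 2) ≤ B ^ (B ^ 3 + 1) := by
  rw [cell_prime_pow_sub_one B u hB.two_le (by omega)]
  set S := (Finset.Icc 1 (B ^ u - 1)).filter
    (fun n => B ≤ Nat.minFac n ∧ ArithmeticFunction.cardFactors n = u - 2) with hS
  have hB1 : 1 < B := hB.one_lt
  -- the cofactor map
  let f : ℕ → ℕ := fun n => n / B ^ n.factorization B
  -- key facts about members of S
  have hmem : ∀ n ∈ S, n ≠ 0 ∧ B ^ n.factorization B * f n = n ∧
      ArithmeticFunction.cardFactors n = n.factorization B + ArithmeticFunction.cardFactors (f n) ∧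
      n.factorization B + ArithmeticFunction.cardFactors (f n) + 2 = u ∧
      1 ≤ f n ∧ f n < B ^ (B ^ 3 + 1) := by
    intro n hn
    rw [hS, Finset.mem_filter, Finset.mem_Icc] at hn
    obtain ⟨⟨hn1, hnx⟩, hminFac, hΩ⟩ := hn
    have hn0 : n ≠ 0 := by omega
    have hdecomp : B ^ n.factorization B * f n = n := Nat.ordProj_mul_ordCompl_eq_self n B
    have hf0 : f n ≠ 0 := (Nat.ordCompl_pos B hn0).ne'
    have hndvd : ¬ B ∣ f n := Nat.not_dvd_ordCompl hB hn0
    have hΩsplit : ArithmeticFunction.cardFactors n =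
        n.factorization B + ArithmeticFunction.cardFactors (f n) := by
      conv_lhs => rw [← hdecomp]
      rw [ArithmeticFunction.cardFactors_mul (pow_ne_zero _ hB.ne_zero) hf0,
        ArithmeticFunction.cardFactors_apply_prime_pow hB]
    have hu' : n.factorization B + ArithmeticFunction.cardFactors (f n) + 2 = u := by omega
    -- prime factors of the cofactor are ≥ B + 1
    have hprimes : ∀ q ∈ (f n).primeFactorsList, B + 1 ≤ q := by
      intro q hq
      have hqprime : q.Prime := Nat.prime_of_mem_primeFactorsList hq
      have hqdvd : q ∣ f n := Nat.dvd_of_mem_primeFactorsList hq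
      have hqn : q ∣ n := hqdvd.trans ⟨B ^ n.factorization B, by rw [mul_comm]; exact hdecomp.symm⟩
      have h1 : B ≤ q := hminFac.trans (Nat.minFac_le_of_dvd hqprime.two_le hqn)
      have h2 : q ≠ B := fun h => hndvd (h ▸ hqdvd)
      omega
    have hlow : (B + 1) ^ ArithmeticFunction.cardFactors (f n) ≤ f n :=
      pow_cardFactors_le_of_le_primeFactors hf0 hprimes
    -- m < B^(Ω m + 2)
    have hhigh : f n < B ^ (ArithmeticFunction.cardFactors (f n) + 2) := by
      have hlt : B ^ n.factorization B * f n < B ^ n.factorization B * B ^ (ArithmeticFunction.cardFactors (f n) + 2) := by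
        rw [hdecomp, ← pow_add, show n.factorization B + (ArithmeticFunction.cardFactors (f n) + 2) = u by omega]
        have : 0 < B ^ u := by positivity
        omega
      exact Nat.lt_of_mul_lt_mul_left hlt
    -- hence Ω m < B³
    have hΩm : ArithmeticFunction.cardFactors (f n) < B ^ 3 := by
      by_contra hge
      push Not at hge
      have := pow_add_two_lt_succ_pow (le_of_lt hB1) hge
      omega
    refine ⟨hn0, hdecomp, hΩsplit, hu', Nat.one_le_iff_ne_zero.mpr hf0, ?_⟩
    calc f n < B ^ (ArithmeticFunction.cardFactors (f n) + 2) := hhigh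
      _ ≤ B ^ (B ^ 3 + 1) := Nat.pow_le_pow_right hB.pos (by omega)
  -- f maps S into Icc 1 M and is injective on S
  have hmaps : Set.MapsTo f (S : Set ℕ) (Finset.Icc 1 (B ^ (B ^ 3 + 1)) : Set ℕ) := by
    intro n hn
    obtain ⟨-, -, -, -, h1, h2⟩ := hmem n hn
    simp only [Finset.coe_Icc, Set.mem_Icc]
    exact ⟨h1, h2.le⟩
  have hinj : Set.InjOn f (S : Set ℕ) := by
    intro n₁ h₁ n₂ h₂ heq
    obtain ⟨-, hd₁, -, hu₁, -, -⟩ := hmem n₁ h₁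
    obtain ⟨-, hd₂, -, hu₂, -, -⟩ := hmem n₂ h₂
    have heq' : f n₁ = f n₂ := heq
    have ha : n₁.factorization B = n₂.factorization B := by
      rw [heq'] at hu₁
      omega
    rw [← hd₁, ← hd₂, ha, heq']
  calc S.card ≤ (Finset.Icc 1 (B ^ (B ^ 3 + 1))).card := Finset.card_le_card_of_injOn f hmaps hinj
    _ = B ^ (B ^ 3 + 1) := by rw [Nat.card_Icc]; omega

/-- Factorials beat powers: for every `M` there is `m ≥ 2` with `M^m < m!`. -/
theorem exists_pow_lt_factorial (M : ℕ) : ∃ m : ℕ, 2 ≤ m ∧ M ^ m < m ! := by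
  rcases Nat.eq_zero_or_pos M with rfl | hM
  · exact ⟨2, le_rfl, by decide⟩
  set k := 2 * M + 2 with hk
  set n := M ^ k with hn
  refine ⟨k + n, by omega, ?_⟩
  have hn2 : M ^ k < 2 ^ n := hn ▸ Nat.lt_two_pow_self
  have hMn : 0 < M ^ n := by positivity
  calc M ^ (k + n) = M ^ k * M ^ n := pow_add _ _ _
    _ < 2 ^ n * M ^ n := Nat.mul_lt_mul_of_lt_of_le hn2 le_rfl hMn
    _ = (2 * M) ^ n := (mul_pow _ _ _).symm
    _ ≤ (k + 1) ^ n := Nat.pow_le_pow_left (by omega) _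
    _ ≤ k ! * (k + 1) ^ n := Nat.le_mul_of_pos_left _ (Nat.factorial_pos k)
    _ ≤ (k + n)! := Nat.factorial_mul_pow_le_factorial

/-! ## §H4 Threshold growth -/

/-- THRESHOLD GROWTH at prime bases: for every prime `B`, `P_{u, B^u − 1}` is not real-rooted for all
large `u`. -/
theorem not_realRootedAt_prime_pow_sub_one {B : ℕ} (hB : B.Prime) :
    ∃ u₀ : ℕ, ∀ u : ℕ, u₀ ≤ u → ¬ RealRootedAt u (B ^ u - 1) := by
  obtain ⟨m, hm2, hm⟩ := exists_pow_lt_factorial (B ^ (B ^ 3 + 1))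
  refine ⟨m + 2, fun u hu => ?_⟩
  refine not_realRootedAt_of_maclaurin (D := u - 1) (m := m) hm2 (by omega) ?_ ?_ ?_
  · intro j hj
    exact cell_eq_zero_of_le (by omega) (by omega)
  · exact one_le_cell_prime_pow_sub_one hB (by omega) (by omega)
  · have hbd : cell u (B ^ u - 1) (u - 1 - 1) ≤ B ^ (B ^ 3 + 1) := by
      rw [show u - 1 - 1 = u - 2 by omega]
      exact cell_prime_pow_sub_one_le hB (by omega)
    have h1 : 1 ≤ cell u (B ^ u - 1) (u - 1 - m) := one_le_cell_prime_pow_sub_one hB (by omega) (by omega)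
    have h2 : 1 ≤ cell u (B ^ u - 1) (u - 1) ^ (m - 1) :=
      Nat.one_le_pow _ _ (one_le_cell_prime_pow_sub_one hB (by omega) (by omega))
    calc cell u (B ^ u - 1) (u - 1 - 1) ^ m ≤ (B ^ (B ^ 3 + 1)) ^ m := Nat.pow_le_pow_left hbd m
      _ < m ! := hm
      _ = m ! * 1 * 1 := by ring
      _ ≤ m ! * cell u (B ^ u - 1) (u - 1 - m) * cell u (B ^ u - 1) (u - 1) ^ (m - 1) :=
          Nat.mul_le_mul (Nat.mul_le_mul_left _ h1) h2

/-- THRESHOLD GROWTH: for every `B` and all large `u`, any `x₀` that serves the crux at level `u`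
satisfies `B^u ≤ x₀`; in other words `x₀(u)^{1/u} → ∞`. -/
theorem threshold_ge_pow (B : ℕ) :
    ∃ u₀ : ℕ, ∀ u : ℕ, u₀ ≤ u → ∀ x₀ : ℕ, (∀ x : ℕ, x₀ ≤ x → RealRootedAt u x) → B ^ u ≤ x₀ := by
  obtain ⟨p, hBp, hp⟩ := Nat.exists_infinite_primes B
  obtain ⟨u₀, hu₀⟩ := not_realRootedAt_prime_pow_sub_one hp
  refine ⟨u₀, fun u hu x₀ hx₀ => ?_⟩
  by_contra hlt
  push Not at hlt
  have hle : B ^ u ≤ p ^ u := Nat.pow_le_pow_left hBp u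
  exact hu₀ u hu (hx₀ _ (by omega))

/-- The natural strengthening "an exponential threshold suffices": `∃ B, ∀ u ≥ 2, ∀ x ≥ B^u, RealRootedAt u x`
(suggested by the exact data `x₀(5) = 7^5, x₀(6) = 7^6, x₀(7) = 7^7`). -/
def ModelHyperbolicityExpThreshold : Prop :=
  ∃ B : ℕ, ∀ u : ℕ, 2 ≤ u → ∀ x : ℕ, B ^ u ≤ x → RealRootedAt u x

/-- It does imply the crux … -/
theorem modelHyperbolicity_of_expThreshold : ModelHyperbolicityExpThreshold → ModelHyperbolicity :=
  fun ⟨B, h⟩ u hu => ⟨B ^ u, h u hu⟩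

/-- … but it is FALSE: no exponential threshold `B^u` serves all large `u`. -/
theorem not_modelHyperbolicityExpThreshold : ¬ ModelHyperbolicityExpThreshold := by
  rintro ⟨B, h⟩
  obtain ⟨u₀, hu₀⟩ := threshold_ge_pow (B + 1)
  set u := max u₀ 2 with hu
  have hge : (B + 1) ^ u ≤ B ^ u := hu₀ u (le_max_left _ _) (B ^ u) (h u (le_max_right _ _))
  have hlt : B ^ u < (B + 1) ^ u := Nat.pow_lt_pow_left (Nat.lt_succ_self B) (by omega)
  omega

/-! ## §I THE UNIT WINDOW SPANS A HYPERBOLIC CONE (gen-4 seat, cycle 3)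

The Lean half of finding (I-b) of the module docstring: non-negative finite combinations of the model
polynomials over a unit window have no zeros off the real axis. Inputs: only the LANDED chain
`WindowChainTransport.stub_windowChain WindowChainTransport.stub_calculus` of the (now proved) positive
line and the elementary SECTOR FUNCTIONAL. Why it sits in the disproof file: it is the structural reason
why the smooth (`li`) model of the finite-`x` polynomial never fails at the TOP, so that the whole
threshold phenomenon `x₀(u)^{1/u} → ∞` of §H is arithmetic (atom at `B` + PNT bias), see (I-c). -/

section WindowCone

open Summit.Parity.GeneralizedHardyLittlewood.Cruxes.ModelHyperbolicity.WindowChainTransport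
open scoped ComplexConjugate

/-- The SECTOR FUNCTIONAL. For `Im z > 0` put `ℓ_z(w) = Re w · (‖z‖ + Re z) + Im w · Im z`
(the inner product with `‖z‖ + z ∈ ℝ_{>0}·e^{i arg z/2}`, the bisector of the sector `0 ≤ arg w < arg z`).
If `w ≠ 0`, `Im w ≥ 0` and `Im (z / w) > 0` — i.e. `arg w ∈ [0, arg z)` — then `ℓ_z(w) > 0`. -/
theorem sector_functional_pos {z w : ℂ} (hz : 0 < z.im) (hw : w ≠ 0) (h1 : 0 ≤ w.im)
    (h2 : 0 < (z / w).im) : 0 < w.re * (‖z‖ + z.re) + w.im * z.im := by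
  have hns : 0 < Complex.normSq w := Complex.normSq_pos.mpr hw
  have key : 0 < z.im * w.re - z.re * w.im := by
    have e : (z / w).im = (z.im * w.re - z.re * w.im) / Complex.normSq w := by
      rw [Complex.div_im]; ring
    rw [e] at h2
    by_contra hcon
    push Not at hcon
    have : (z.im * w.re - z.re * w.im) / Complex.normSq w ≤ 0 :=
      div_nonpos_of_nonpos_of_nonneg hcon hns.le
    linarith
  have hnorm : ‖z‖ ^ 2 = z.re ^ 2 + z.im ^ 2 := by
    rw [Complex.sq_norm, Complex.normSq_apply]; ring
  have hz0 : z ≠ 0 := by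
    intro h; rw [h] at hz; simp at hz
  have hr0 : 0 < ‖z‖ := norm_pos_iff.mpr hz0
  have hre : z.re ≤ ‖z‖ := Complex.re_le_norm z
  have hrc : 0 < ‖z‖ + z.re := by nlinarith
  rcases h1.eq_or_lt with h0 | hpos
  · -- `w` is a positive real
    rw [← h0] at key ⊢
    have ha : 0 < w.re := by nlinarith
    nlinarith
  · have hmain : z.im * (w.re * (‖z‖ + z.re) + w.im * z.im) =
        (z.im * w.re - z.re * w.im) * (‖z‖ + z.re) + w.im * ‖z‖ * (‖z‖ + z.re) := by
      linear_combination (-w.im) * hnorm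
    have hprod : 0 < z.im * (w.re * (‖z‖ + z.re) + w.im * z.im) := by
      rw [hmain]
      have t1 : 0 < (z.im * w.re - z.re * w.im) * (‖z‖ + z.re) := mul_pos key hrc
      have t2 : 0 < w.im * ‖z‖ * (‖z‖ + z.re) := mul_pos (mul_pos hpos hr0) hrc
      linarith
    by_contra hcon
    push Not at hcon
    nlinarith

/-- `G_N(τ; conj z) = conj (G_N(τ; z))` (real coefficients). -/
theorem modelEval_conj (N : ℕ) (τ : ℝ) (z : ℂ) :
    modelEval N τ (conj z) = conj (modelEval N τ z) := by
  unfold modelEval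
  rw [map_sum]
  refine Finset.sum_congr rfl fun j _ => ?_
  rw [map_mul, map_pow, Complex.conj_ofReal]

/-- **The unit window spans a hyperbolic cone (upper half-plane form).** Under `WindowChain N`: for
`1 ≤ a`, `a + 1 ≤ N`, finitely many nodes `v i ∈ [a, a+1]` and weights `w i ≥ 0` not all zero, the
combination `Σ_i w_i · G_N(v_i; z)` does not vanish for `Im z > 0`. Proof: by the chain applied to the
pairs `(a, v_i)`, every `g_i = G(v_i)/G(a)` lies in the sector `{Im g ≥ 0, Im(z/g) > 0}`, on which the
sector functional `ℓ_z` is positive; `ℓ_z` is `ℝ`-linear, so `ℓ_z(Σ w_i g_i) > 0`. -/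
theorem window_combination_ne_zero_of_chain {N : ℕ} (hW : WindowChain N) {a : ℝ} (ha : 1 ≤ a)
    (haN : a + 1 ≤ (N : ℝ)) {ι : Type*} (s : Finset ι) (v : ι → ℝ) (w : ι → ℝ)
    (hv : ∀ i ∈ s, a ≤ v i ∧ v i ≤ a + 1) (hw : ∀ i ∈ s, 0 ≤ w i) (hpos : ∃ i ∈ s, 0 < w i)
    {z : ℂ} (hz : 0 < z.im) :
    ∑ i ∈ s, (w i : ℂ) * modelEval N (v i) z ≠ 0 := by
  have hchain : ∀ i ∈ s, modelEval N a z ≠ 0 ∧ modelEval N (v i) z ≠ 0 ∧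
      0 ≤ (modelEval N (v i) z / modelEval N a z).im ∧
      0 < (z * modelEval N a z / modelEval N (v i) z).im := fun i hi =>
    hW a (v i) ha (hv i hi).1 (hv i hi).2 (le_trans (hv i hi).2 haN) z hz
  obtain ⟨i₀, hi₀, hwi₀⟩ := hpos
  have hGa : modelEval N a z ≠ 0 := (hchain i₀ hi₀).1
  -- the sector functional and its positivity on every `g_i`
  set ℓ : ℂ → ℝ := fun q => q.re * (‖z‖ + z.re) + q.im * z.im with hℓ
  have hℓpos : ∀ i ∈ s, 0 < ℓ (modelEval N (v i) z / modelEval N a z) := by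
    intro i hi
    obtain ⟨h1, h2, h3, h4⟩ := hchain i hi
    refine sector_functional_pos hz (div_ne_zero h2 h1) h3 ?_
    have e : z / (modelEval N (v i) z / modelEval N a z) =
        z * modelEval N a z / modelEval N (v i) z := by
      field_simp
    rw [e]; exact h4
  intro hsum
  -- normalised sum vanishes too
  have hsum' : ∑ i ∈ s, (w i : ℂ) * (modelEval N (v i) z / modelEval N a z) = 0 := by
    have e : ∑ i ∈ s, (w i : ℂ) * (modelEval N (v i) z / modelEval N a z) =
        (∑ i ∈ s, (w i : ℂ) * modelEval N (v i) z) / modelEval N a z := by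
      rw [Finset.sum_div]
      exact Finset.sum_congr rfl fun i _ => by ring
    rw [e, hsum, zero_div]
  -- ℓ of the normalised sum, computed termwise
  have hℓsum : ℓ (∑ i ∈ s, (w i : ℂ) * (modelEval N (v i) z / modelEval N a z)) =
      ∑ i ∈ s, w i * ℓ (modelEval N (v i) z / modelEval N a z) := by
    simp only [hℓ, Complex.re_sum, Complex.im_sum, Complex.re_ofReal_mul, Complex.im_ofReal_mul,
      Finset.sum_mul, ← Finset.sum_add_distrib]
    exact Finset.sum_congr rfl fun i _ => by ring
  have hpos' : 0 < ∑ i ∈ s, w i * ℓ (modelEval N (v i) z / modelEval N a z) :=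
    Finset.sum_pos' (fun i hi => mul_nonneg (hw i hi) (hℓpos i hi).le)
      ⟨i₀, hi₀, mul_pos hwi₀ (hℓpos i₀ hi₀)⟩
  rw [← hℓsum, hsum'] at hpos'
  simp [hℓ] at hpos'

/-- **Unconditional form** (the chain is LANDED: `stub_windowChain stub_calculus`): every non-negative,
not identically zero, finite combination of the model polynomials `G(v; ·)` over a unit window
`v ∈ [a, a+1]`, `1 ≤ a`, has NO zero off the real axis. (With `N = ⌈a⌉₊ + 1` the truncation
`modelEval N` is the full model family on `[1, N]`.) This is the structural reason why, in the
`li`-model of §I, no TOP window of the finite-`x` polynomial ever fails: the weight `y^v dv/v` restricted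
to `[u−1, u]` is such a combination (Riemann sums + Hurwitz), cf. the numerics in the module docstring. -/
theorem window_combination_ne_zero {N : ℕ} {a : ℝ} (ha : 1 ≤ a) (haN : a + 1 ≤ (N : ℝ))
    {ι : Type*} (s : Finset ι) (v : ι → ℝ) (w : ι → ℝ)
    (hv : ∀ i ∈ s, a ≤ v i ∧ v i ≤ a + 1) (hw : ∀ i ∈ s, 0 ≤ w i) (hpos : ∃ i ∈ s, 0 < w i)
    {z : ℂ} (hz : z.im ≠ 0) :
    ∑ i ∈ s, (w i : ℂ) * modelEval N (v i) z ≠ 0 := by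
  have hW : WindowChain N := (stub_windowChain stub_calculus).1 N
  rcases lt_or_gt_of_ne hz with hneg | hposim
  · -- lower half-plane: conjugate
    have hz' : 0 < (conj z).im := by simp; linarith
    have h := window_combination_ne_zero_of_chain hW ha haN s v w hv hw hpos hz'
    intro hsum
    apply h
    have e : ∑ i ∈ s, (w i : ℂ) * modelEval N (v i) (conj z) =
        conj (∑ i ∈ s, (w i : ℂ) * modelEval N (v i) z) := by
      rw [map_sum]
      exact Finset.sum_congr rfl fun i _ => by rw [map_mul, Complex.conj_ofReal, modelEval_conj]
    rw [e, hsum, map_zero]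
  · exact window_combination_ne_zero_of_chain hW ha haN s v w hv hw hpos hposim

/-- **Integral form** (continuous positive weights; covers the `li`-model weight `y^v/v`): for `1 ≤ a`,
`a + 1 ≤ N`, a weight `w` continuous and positive on `[a, a+1]`, and `Im z > 0` with the chain at level
`N`, `∫_a^{a+1} w(v)·G_N(v; z) dv ≠ 0`. Proof: normalise by `G_N(a;z)`, push the sector functional
(an `ℝ`-linear continuous map `ℂ → ℝ`) through the integral, and use positivity of the integral of a
continuous positive function. -/
theorem window_integral_ne_zero_of_chain {N : ℕ} (hcont : ∀ z : ℂ, Continuous fun τ : ℝ => modelEval N τ z)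
    (hW : WindowChain N) {a : ℝ} (ha : 1 ≤ a) (haN : a + 1 ≤ (N : ℝ)) (w : ℝ → ℝ)
    (hw : ContinuousOn w (Set.Icc a (a + 1))) (hwpos : ∀ v ∈ Set.Icc a (a + 1), 0 < w v)
    {z : ℂ} (hz : 0 < z.im) :
    ∫ v in a..(a + 1), (w v : ℂ) * modelEval N v z ≠ 0 := by
  have hchain : ∀ v ∈ Set.Icc a (a + 1), modelEval N a z ≠ 0 ∧ modelEval N v z ≠ 0 ∧
      0 ≤ (modelEval N v z / modelEval N a z).im ∧
      0 < (z * modelEval N a z / modelEval N v z).im := fun v hv =>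
    hW a v ha hv.1 hv.2 (le_trans hv.2 haN) z hz
  have haa : a ∈ Set.Icc a (a + 1) := ⟨le_rfl, by linarith⟩
  have hGa : modelEval N a z ≠ 0 := (hchain a haa).1
  -- the sector functional as a continuous `ℝ`-linear map
  set L : ℂ →L[ℝ] ℝ := (‖z‖ + z.re) • Complex.reCLM + z.im • Complex.imCLM with hL
  have hLapply : ∀ q : ℂ, L q = q.re * (‖z‖ + z.re) + q.im * z.im := by
    intro q
    simp only [hL, add_apply, FunLike.coe_smul, Pi.smul_apply, Complex.reCLM_apply,
      Complex.imCLM_apply, smul_eq_mul]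
    ring
  -- positivity of `L` on the normalised integrand
  have hLpos : ∀ v ∈ Set.Icc a (a + 1),
      0 < L ((w v : ℂ) * (modelEval N v z / modelEval N a z)) := by
    intro v hv
    obtain ⟨h1, h2, h3, h4⟩ := hchain v hv
    have hsec : 0 < (modelEval N v z / modelEval N a z).re * (‖z‖ + z.re) +
        (modelEval N v z / modelEval N a z).im * z.im := by
      refine sector_functional_pos hz (div_ne_zero h2 h1) h3 ?_
      have e : z / (modelEval N v z / modelEval N a z) = z * modelEval N a z / modelEval N v z := by
        field_simp
      rw [e]; exact h4
    rw [hLapply, Complex.re_ofReal_mul, Complex.im_ofReal_mul]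
    have e : w v * (modelEval N v z / modelEval N a z).re * (‖z‖ + z.re) +
        w v * (modelEval N v z / modelEval N a z).im * z.im =
        w v * ((modelEval N v z / modelEval N a z).re * (‖z‖ + z.re) +
          (modelEval N v z / modelEval N a z).im * z.im) := by ring
    rw [e]
    exact mul_pos (hwpos v hv) hsec
  -- continuity / integrability of the normalised integrand
  have hab : a ≤ a + 1 := by linarith
  have hcontOn : ContinuousOn (fun v : ℝ => (w v : ℂ) * (modelEval N v z / modelEval N a z))
      (Set.Icc a (a + 1)) := by
    refine ContinuousOn.mul (Complex.continuous_ofReal.comp_continuousOn hw) ?_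
    exact ((hcont z).div_const _).continuousOn
  have hint : IntervalIntegrable (fun v : ℝ => (w v : ℂ) * (modelEval N v z / modelEval N a z))
      MeasureTheory.volume a (a + 1) :=
    hcontOn.intervalIntegrable_of_Icc hab
  have hintL : IntervalIntegrable (fun v : ℝ => L ((w v : ℂ) * (modelEval N v z / modelEval N a z)))
      MeasureTheory.volume a (a + 1) :=
    (L.continuous.comp_continuousOn hcontOn).intervalIntegrable_of_Icc hab
  have hposInt : 0 < ∫ v in a..(a + 1), L ((w v : ℂ) * (modelEval N v z / modelEval N a z)) :=
    intervalIntegral.intervalIntegral_pos_of_pos_on hintL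
      (fun v hv => hLpos v (Set.Ioo_subset_Icc_self hv)) (by linarith)
  -- now assume the integral vanishes and push `L` through
  intro hzero
  have hnorm : ∫ v in a..(a + 1), (w v : ℂ) * (modelEval N v z / modelEval N a z) = 0 := by
    have e : (fun v : ℝ => (w v : ℂ) * (modelEval N v z / modelEval N a z)) =
        fun v : ℝ => ((w v : ℂ) * modelEval N v z) / modelEval N a z := by
      funext v; ring
    rw [e, intervalIntegral.integral_div, hzero, zero_div]
  have hcomm := L.intervalIntegral_comp_comm hint
  -- hcomm : ∫ L (f v) = L (∫ f v)
  rw [hnorm, map_zero] at hcomm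
  linarith

/-- **Integral form, unconditional** (`stub_windowChain stub_calculus`, `calc_continuous_modelEval`), for
`Im z ≠ 0`: with a continuous positive weight on a unit window, `∫_a^{a+1} w(v) G_N(v;z) dv ≠ 0`. In
particular the window part `∫_{u−1}^u y^v G(v;t) dv/v` of the `li`-model cell polynomial has only real
zeros, for every `y > 0`. -/
theorem window_integral_ne_zero {N : ℕ} {a : ℝ} (ha : 1 ≤ a) (haN : a + 1 ≤ (N : ℝ)) (w : ℝ → ℝ)
    (hw : ContinuousOn w (Set.Icc a (a + 1))) (hwpos : ∀ v ∈ Set.Icc a (a + 1), 0 < w v)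
    {z : ℂ} (hz : z.im ≠ 0) :
    ∫ v in a..(a + 1), (w v : ℂ) * modelEval N v z ≠ 0 := by
  have hW : WindowChain N := (stub_windowChain stub_calculus).1 N
  have hcont : ∀ z : ℂ, Continuous fun τ : ℝ => modelEval N τ z := calc_continuous_modelEval N
  rcases lt_or_gt_of_ne hz with hneg | hposim
  · have hz' : 0 < (conj z).im := by simp; linarith
    have h := window_integral_ne_zero_of_chain hcont hW ha haN w hw hwpos hz'
    intro hzero
    apply h
    have e : (fun v : ℝ => (w v : ℂ) * modelEval N v (conj z)) =
        fun v : ℝ => conj ((w v : ℂ) * modelEval N v z) := by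
      funext v; rw [map_mul, Complex.conj_ofReal, modelEval_conj]
    have hab : a ≤ a + 1 := by linarith
    rw [e, intervalIntegral.integral_of_le hab, integral_conj, ← intervalIntegral.integral_of_le hab,
      hzero, map_zero]
  · exact window_integral_ne_zero_of_chain hcont hW ha haN w hw hwpos hposim

end WindowCone

end Summit.Parity.GeneralizedHardyLittlewood.Cruxes.ModelHyperbolicity.Disproof
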